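import Literature.NumberTheory.Transcendental.ZilberEclIsoCross
import Literature.NumberTheory.Transcendental.ZilberClassAxioms
import Literature.NumberTheory.Transcendental.SEACNonSplitting
import Literature.ModelTheory.Quasiminimal.PregeometryMatroid
import Literature.Combinatorics.Matroid.RelRankFinitary
import HarnessLib

/-!
# The class of Zilber fields: `ℵ₀`-homogeneity over countable closed subsets, across two members (Bays–Kirby 2013, Prop. 5)

Hypotheses `h₄₃` and `h₄₄` of `ZilberClass.isQuasiminimalPregeometryClass_of`
(`ZilberClassAxioms.lean`) — the two clauses of axiom II / (4) of a quasiminimal pregeometry class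
(Kirby 2010; Haykazyan 2016, Def. 2) over countable CLOSED subsets, for the class `ZilberClass` of
Zilber fields in the closure-isomorphism language `Language.eclIso`, ACROSS two members `H ⊇ G`,
`H' ⊇ g G` — proved: `ZilberClass.eqQFTypeOver₂_of_notMem_of_closed` (Part I) and
`ZilberClass.exists_eqQFTypeOver₂_snoc_of_closed` (Part V). This is M. Bays, J. Kirby, *Excellence
and uncountable categoricity of Zilber's exponential fields* (2013), Prop. 5, across two fields,
along its printed proof (Kirby 2010 Thm 2.1 for (i); the Kummer-genericity argument for (ii)),
with the cross-field `ℵ₀`-saturation of `GammaIsoCrossProp112.lean` and the cross-field Thm 2.1 of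
`ZilberEclIsoCross.lean` as the engine. The file has five parts (formerly separate files
`ZilberClassHomogeneity`, `ZilberHomogeneityLemmas`, `ZilberLevelZeroGenericity`,
`ZilberGammaStateTypes`, `ZilberClassHomogeneityII` of the author's folder, concatenated in
dependency order); their individual introductions follow. Everything is proved; no named fact is
introduced.

## Part I (ZilberClassHomogeneity)

### The class of Zilber fields: `ℵ₀`-homogeneity over countable closed subsets, across two members

Hypothesis `h₄₃` of `ZilberClass.isQuasiminimalPregeometryClass_of` (`ZilberClassAxioms.lean`) —
axiom (4i) of a quasiminimal pregeometry class (Haykazyan 2016, Def. 2) over countable CLOSED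
subsets, for the class `ZilberClass` of Zilber fields in the closure-isomorphism language
`Language.eclIso`, ACROSS two members — **proved**: if `G ⊆ H` is countable and closed, `g` is a
partial embedding on `G` with closed image, and `x ∉ cl G`, `x' ∉ cl (g G)`, then
`qftp(G, x) = qftp(g G, x')` along `g` (`ZilberClass.eqQFTypeOver₂_of_notMem_of_closed`).

Proof: a partial `Language.eclIso`-embedding on an `ecl`-closed `G` is an isomorphism of
exponential fields `G ≅ g G` (`isEIsoOn₂_of_isPartialEmbOn`: the language has the function
symbols `+, ·, exp`); by the cross-field form of Kirby 2010, Thm 2.1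
(`IsZilberField.eclIso_extension₂`, `ZilberEclIsoCross.lean` — back-and-forth through cross
Γ-isomorphisms, engine: the cross-field twisted `ℵ₀`-saturation of Bays–Kirby Prop. 11.2) it
extends with `x ↦ x'` to an isomorphism `Θ : ecl(G, x) ≅ ecl(g G, x')`; restricting `Θ` to the
closure of any finite `b̄ ⊆ G` followed by `x` gives an isomorphism of pointed closures, i.e.
equality of quantifier-free `Language.eclIso`-types (`eqQFType₂_of_eHom`, `ZilberCategoricity.lean`)
— `eqQFTypeOver₂_of_isEIsoOn₂`. The same lemma gives axiom (4ii) over closed sets in ISOMORPHISM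
form (`exists_eqQFTypeOver₂_snoc_of_isEIsoOn₂`: along an isomorphism of closures `Θ ⊇ g ∪ (x̄ ↦ x̄')`
every `y ∈ ecl(G, x̄)` has the partner `Θ y`); the remaining step to hypothesis `h₄₄` as stated
(from `qftp(G, x̄) = qftp(g G, x̄')` alone) is Bays–Kirby 2013, Prop. 5 (ii) and is NOT done here.
Everything here is proved; no named fact is introduced.

## References

* L. Haykazyan, *Categoricity in quasiminimal pregeometry classes*, J. Symbolic Logic 81 (2016):
  Def. 2 (4).
* J. Kirby, *On quasiminimal excellent classes*, J. Symbolic Logic 75 (2010): Def. 1.1 (axiom II),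
  Thm 2.1, Prop. 3.5.
* M. Bays, J. Kirby, *Excellence and uncountable categoricity of Zilber's exponential fields*,
  arXiv:1305.0493 (2013): Prop. 5.

## Part II (ZilberHomogeneityLemmas)

### Lemmas for `ℵ₀`-homogeneity over closed sets across two Zilber fields (Bays–Kirby 2013, Prop. 5 (ii))

Infrastructure for the proof of axiom (4ii) of a quasiminimal pregeometry class over countable
closed subsets for the class of Zilber fields across two members (hypothesis `h₄₄` of
`ZilberClass.isQuasiminimalPregeometryClass_of`), following M. Bays, J. Kirby, *Excellence and
uncountable categoricity of Zilber's exponential fields* (2013), Prop. 5 (ii):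

* `Matroid.IsBasis'.image_of_forall_indep_iff`, `Matroid.relRank_image_eq` — relative rank is
  invariant under a map injective on a set `D` which preserves independence of subsets of `D`
  (both matroids with ground set everything);
* `Matroid.contract_indep_union_of_relRank_eq` — the "independence transfer" count: if `X₀` is
  independent over `C`, `C ⊆ D ⊇ X₀`, and `rk(Y/D) = rk(Y/C) < ∞`, then `X₀` is independent over
  `C ∪ Y` (symmetry of independence, through the addition formula for relative rank);
* `IsEIsoOn₂.relRank_ecl_image_eq`, `IsEIsoOn₂.relRank_alg_image_eq` — an isomorphism of
  `ecl`-closed exponential subfields of two fields preserves relative `ecl`-dimension and relative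
  transcendence degree of subsets;
* `IsEIsoOn₂.map_ratCast`, `map_smul_of_mem`, `map_sum_smul` — `ℚ`-linearity on the closed set;
* `GammaField.IsGammaIsoTw₂.of_base_le` — a cross Γ-isomorphism over an isomorphism of base
  Γ-fields descends to smaller base Γ-fields on which the isomorphism restricts.

Everything here is proved; no named fact is introduced.

## References

* M. Bays, J. Kirby, *Excellence and uncountable categoricity of Zilber's exponential fields*,
  arXiv:1305.0493 (2013): Prop. 5 (proof).
* J. Oxley, *Matroid Theory*, 2nd ed., OUP 2011: §3.3.

## Part III (ZilberLevelZeroGenericity)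

### Cross Γ-isomorphisms over Γ-closed bases from level-`0` genericity (Bays–Kirby 2013, Prop. 5 (ii), core)

The Γ-field core of M. Bays, J. Kirby, *Excellence and uncountable categoricity of Zilber's
exponential fields* (2013), proof of Prop. 5 (ii) ("`(d', exp d')` is generic over `G` in `V`, so
by Kummer-genericity of `V` … `d' ≡_G d`"), across two fields: let `K₂ ≤ K` be Γ-closed,
`σ : K₂⁰ ≅ K₂'⁰` an isomorphism onto the Γ-field of `K₂' ≤ K'`, `d` a tuple of `K` whose
exponentials are Kummer-independent in `K₂⁰(d, exp d)` (a normalised basis), and `d'` a tuple of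
`K'` of the same length. If `(d', exp d')` is a zero of the `σ`-transport of the level-`0` locus
ideal of `(d, exp d)` over `K₂⁰` and `td(d'/K₂') ≥ td(d/K₂)`, then `d ↦ d'` is a cross
Γ-isomorphism over `σ` (`GammaField.isGammaIsoTw₂_of_mem_zeroLocus_of_td_le`): the point is generic
in the transported locus for dimension reasons (`LocusComponents.isGenericPt_of_trdeg_le`), which
gives a level-`0` embedding `K₂⁰(d, exp d) → K'` over `σ` (`pointFieldHom₂`), and Kummer
genericity lifts it to all levels (`IsGammaIsoTw₂.append_of_ringHom_adjoin`,
`GammaIsoCrossSteps.lean`). Also: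

* `GammaField.exists_normalised_hull` — over a Γ-closed `K₂` in an algebraically closed `K`, every
  finite tuple lies in a finitely generated strong `K₂ + ℚd ⊆ span ecl(K₂ ∪ w̄)` with `d` a
  normalised basis (hulls, `IsStrong.exists_isStrong_of_le`; normalisation,
  `exists_relative_normalised_basis` with empty parameter tuple);
* `GammaField.gammaPt_mem_zeroLocus_locusIdealTw₂_of_eHom` — zeros of the transported level-`0`
  ideal from an E-ring embedding agreeing with `σ` on the (finitely many) coefficients of its
  generators.

Everything is proved; no named fact is introduced.

## References

* M. Bays, J. Kirby, *Excellence and uncountable categoricity of Zilber's exponential fields*,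
  arXiv:1305.0493 (2013): Lemma 3, Prop. 2, Prop. 5 (proof).
* M. Bays, J. Kirby, *Pseudo-exponential maps, variants, and quasiminimality*, Algebra & Number
  Theory 12 (2018): Prop. 3.22, Prop. 3.24, Def. 4.6, Lemma 8.3 (proof).

## Part IV (ZilberGammaStateTypes)

### From cross Γ-isomorphisms over closed bases to quantifier-free types over closed sets (Bays–Kirby 2013, Lemma 3, two fields)

M. Bays, J. Kirby, *Excellence and uncountable categoricity of Zilber's exponential fields*
(2013), Lemma 3 ("strong partial E-field isomorphisms preserve quantifier-free types over the
base", after Zilber 2005 §5), in the closure-isomorphism language `Language.eclIso` and across two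
Zilber fields `K`, `K'`: if `g : S ≅ g S` is an isomorphism of countable `ecl`-closed subsets with
induced isomorphism `σ` of base Γ-fields, and `d ↦ d'` is a cross Γ-isomorphism over `σ`
(`GammaField.IsGammaIsoTw₂`) whose spans over the closed sub-bases `ecl b`, `ecl (g b)` of a cofinal
family of finite `b ⊆ S` are strong, then every tuple `x ⊆ span S + ℚd` and its transport `x'`
have the same quantifier-free `Language.eclIso`-type over `S` along `g`
(`ZilberHomogeneity.eqQFTypeOver₂_of_isGammaIsoTw₂`): descend the Γ-isomorphism to the base
`ecl b` (`IsGammaIsoTw₂.of_base_le`), extend `g|ecl b ∪ (d ↦ d')` to an isomorphism of closures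
(`exists_isEIsoOn₂_of_isGammaIsoTw₂`, the cross-field Kirby 2010 Thm 2.1) and read off the types
(`eqQFTypeOver₂_of_isEIsoOn₂`). Supporting Γ-field lemmas:

* `GammaField.isStrong_sup_span_of_td_eq` — strongness descends to a strong sub-base `K_b ≤ K₂`
  once `td(d/K_b) = td(d/K₂)` (addition formula and submodularity of `δ`);
* `GammaField.td_span_range_eq_relRank`, `ZilberHomogeneity.exists_finset_forall_td_eq` — the
  transcendence degree of `d` over `span ecl T` is attained on a finite subset of the closed base
  (finitarity of the algebraic matroid, `Matroid.exists_finite_subset_relRank_eq`);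
* `ZilberHomogeneity.isStrong_image_of_isEIsoOn₂` — strongness is transported along isomorphisms
  of `ecl`-closed sets (predimensions of finite tuples inside the closed set are preserved:
  `IsEIsoOn₂.relRank_alg_image_eq`, `IsEIsoOn₂.map_sum_smul`; reduction to tuples inside the
  closed set by submodularity, `GammaField.isStrong_of_forall_finset_subset`).

Everything is proved; no named fact is introduced.

## References

* M. Bays, J. Kirby, *Excellence and uncountable categoricity of Zilber's exponential fields*,
  arXiv:1305.0493 (2013): Lemma 3, Prop. 5 (proof).
* M. Bays, J. Kirby, *Pseudo-exponential maps, variants, and quasiminimality*, Algebra & Number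
  Theory 12 (2018): Lemma 4.2, Def. 4.3, Lemma 4.5.
* B. Zilber, *Pseudo-exponentiation on algebraically closed fields of characteristic zero*,
  Ann. Pure Appl. Logic 132 (2005): §5.

## Part V (ZilberClassHomogeneityII)

### The class of Zilber fields: `ℵ₀`-homogeneity over countable closed subsets (ii), across two members (Bays–Kirby 2013, Prop. 5 (ii))

Hypothesis `h₄₄` of `ZilberClass.isQuasiminimalPregeometryClass_of` (`ZilberClassAxioms.lean`) —
axiom (4ii) of a quasiminimal pregeometry class (Haykazyan 2016, Def. 2) over countable CLOSED
subsets for the class `ZilberClass` of Zilber fields in `Language.eclIso`, ACROSS two members: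
if `G ⊆ H` is countable and closed, `g ∪ (x̄ ↦ x̄')` is a partial embedding on `G ∪ x̄` with `g G`
closed, and `ȳ ⊆ cl(G ∪ x̄)`, then there is `ȳ'` with `g ∪ (x̄ȳ ↦ x̄'ȳ')` a partial embedding
(`ZilberClass.exists_eqQFTypeOver₂_snoc_of_closed`, in the `snoc` form of the axiom, from
`exists_eqQFTypeOver₂_append_of_closed`). This is M. Bays, J. Kirby, *Excellence and uncountable
categoricity of Zilber's exponential fields* (2013), Prop. 5 (ii), whose proof we follow across the
two fields `K ⊇ G`, `K' ⊇ g G`: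

1. (hull, "`⟨Gd⟩ ◁ B`, Kummer-generic") `x̄ȳ` lies in a strong `span G + ℚd` with `d` a normalised
   basis (`GammaField.exists_normalised_hull`);
2. ("`G₀ ◁ G` finitely generated with `V` over `G₀`") a finite `b₀ ⊆ G` containing the coefficients
   of generators of the level-`0` locus ideal of `(d, exp d)` over `G`, the supports of `x̄ȳ`, and
   large enough for the `ecl`-dimension and the transcendence degree of `d` over `G` to be attained
   over `ecl b₀` (`Matroid.exists_finite_subset_relRank_eq`, `exists_finset_forall_td_eq`), with
   `d ⊆ ecl(b₀, x̄)`;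
3. ("by `ℵ₀`-homogeneity over `∅`, `c'd' ≡_{G₀} cd`") the hypothesis at the finite tuple `b₀` gives an
   isomorphism `θ₀ : ecl(b₀, x̄) ≅ ecl(g b₀, x̄')` (`exists_eHom_of_eqQFType₂`); put `d' = θ₀ d`,
   `ȳ' = θ₀ ȳ`; then `(d', exp d')` is a zero of the `σ`-transported locus ideal
   (`GammaField.gammaPt_mem_zeroLocus_locusIdealTw₂_of_eHom`);
4. ("`G` is `ecl`-independent from `d` over `G₀` … by uniqueness of generics `d' ≡_{G₀X} d` … the
   same holds of `(d', exp d')`") along finite subsets `X₀` of a basis `X` of `G` over `ecl b₀`,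
   independent over `ecl(b₀, x̄)` by the dimension count (`Matroid.contract_indep_union_of_relRank_eq`)
   and on the `g`-side by the hypothesis (`mem_ecl_image_iff_of_eqQFType₂`), `θ₀` extends to
   isomorphisms `Θ : ecl(b₀, X₀, x̄) ≅ ecl(g b₀, g X₀, x̄')` (`IsZilberField.eclIso_extension₂`
   iterated, `exists_isEIsoOn₂_chain`), whence `td(d'/g G) ≥ td(d/G)`
   (`IsEIsoOn₂.relRank_alg_image_eq` and finitarity);
5. ("so `(d', exp d')` is generic in `V` … by Kummer-genericity and Lemma 3, `d' ≡_G d`") `d ↦ d'` is a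
   cross Γ-isomorphism over `σ` (`GammaField.isGammaIsoTw₂_of_mem_zeroLocus_of_td_le`) whose spans
   over the closed sub-bases `ecl(b₀ X₀)` are strong on both sides
   (`GammaField.isStrong_sup_span_of_td_eq`, `isStrong_image_of_isEIsoOn₂`), so the types over `G`
   agree (`eqQFTypeOver₂_of_isGammaIsoTw₂`).

Everything is proved; no named fact is introduced. With `ZilberPrimeModelIso.lean` (`h₂`) and
`ZilberClassHomogeneity.lean` (`h₄₃`) this leaves, of the hypotheses of
`ZilberClass.isQuasiminimalPregeometryClass_of`, only `h₃` (closed E-subfields of Zilber fields are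
Zilber fields).

## References

* M. Bays, J. Kirby, *Excellence and uncountable categoricity of Zilber's exponential fields*,
  arXiv:1305.0493 (2013): Lemma 3, Prop. 2, Prop. 5.
* L. Haykazyan, *Categoricity in quasiminimal pregeometry classes*, J. Symbolic Logic 81 (2016):
  Def. 2 (4ii).
* J. Kirby, *On quasiminimal excellent classes*, J. Symbolic Logic 75 (2010): Thm 2.1, Prop. 3.5.
-/

noncomputable section

open Set
open FirstOrder FirstOrder.Language
open Literature.ModelTheory.ExponentialFields Literature.ModelTheory.Quasiminimal

universe u

/-! ## Part I — from `ZilberClassHomogeneity` -/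

namespace Literature.NumberTheory.Transcendental

/-! ### Partial `Language.eclIso`-embeddings on closed sets are isomorphisms of exponential fields -/

section PartialEmb

variable {K : Type*} [Field K] [ExponentialRing K] {K' : Type*} [Field K'] [ExponentialRing K']

/-- **A partial `Language.eclIso`-embedding on an `ecl`-closed set is an isomorphism of exponential
fields onto its image** (the language has the function symbols `+, ·, exp`, and `ecl G = G` is an
E-subfield, Kirby 2010 Lemma 3.3). [cite: Kirby2010QMEC, Def. 1.1] -/
theorem isEIsoOn₂_of_isPartialEmbOn {G : Set K} (hG : ecl G = G) {g : K → K'}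
    (hg : IsPartialEmbOn Language.eclIso g G) : IsEIsoOn₂ g G (g '' G) := by
  have hadd : ∀ ⦃u v : K⦄, u ∈ G → v ∈ G → u + v ∈ G := fun u v hu hv => by
    rw [← hG] at hu hv ⊢; exact Khovanskii.add_mem_ecl hu hv
  have hmul : ∀ ⦃u v : K⦄, u ∈ G → v ∈ G → u * v ∈ G := fun u v hu hv => by
    rw [← hG] at hu hv ⊢; exact Khovanskii.mul_mem_ecl hu hv
  have hexp : ∀ ⦃u : K⦄, u ∈ G → ExponentialRing.exp u ∈ G := fun u hu => by
    rw [← hG] at hu ⊢; exact Khovanskii.exp_mem_ecl hu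
  refine ⟨⟨mapsTo_image g G, hg.injOn, surjOn_image g G⟩, fun u v hu hv => ?_, fun u v hu hv => ?_,
    fun u hu => ?_⟩
  · have := hg.apply_funMap expRingFunc.add (x := ![u, v])
      (fun i => by fin_cases i <;> [exact hu; exact hv]) (by simpa using hadd hu hv)
    simpa using this
  · have := hg.apply_funMap expRingFunc.mul (x := ![u, v])
      (fun i => by fin_cases i <;> [exact hu; exact hv]) (by simpa using hmul hu hv)
    simpa using this
  · have := hg.apply_funMap expRingFunc.exp (x := ![u])
      (fun i => by fin_cases i; exact hu) (by simpa using hexp hu)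
    simpa using this

end PartialEmb

/-! ### Quantifier-free types over closed sets from isomorphisms of closures -/

section OverClosed

variable {K : Type} [Field K] [ExponentialRing K] {K' : Type} [Field K'] [ExponentialRing K']

/-- **An isomorphism of closures over `g` gives equal quantifier-free types over `G`**: if
`Θ : ecl(G ∪ x̄) ≅ ecl(S')` is an isomorphism of exponential fields (as a map `K → K'`) which is `g`
on `G` and maps `x̄ ↦ x̄'`, then `qftp(G, x̄) = qftp(g G, x̄')` along `g` in `Language.eclIso`:
restrict `Θ` to the closure of `b̄ x̄` for finite `b̄ ⊆ G` (`IsEIsoOn₂.restrict`) and read off the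
quantifier-free type (`eqQFType₂_of_eHom`). [cite: Kirby2010QMEC, Prop. 3.5] [cite: Haykazyan2016, Definition 2] -/
theorem eqQFTypeOver₂_of_isEIsoOn₂ {G : Set K} {S' : Set K'} {g Θ : K → K'} {n : ℕ} {x : Fin n → K}
    {x' : Fin n → K'} (hΘ : IsEIsoOn₂ Θ (ecl (G ∪ range x)) (ecl S')) (hΘg : EqOn Θ g G)
    (hΘx : ∀ i, Θ (x i) = x' i) : Language.eclIso.EqQFTypeOver₂ G g x x' := by
  intro m b hb
  set t : Fin (m + n) → K := Fin.append b x with ht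
  set t' : Fin (m + n) → K' := Fin.append (g ∘ b) x' with ht'
  have hΘt : ∀ i, Θ (t i) = t' i := by
    intro i
    refine Fin.addCases (fun j => ?_) (fun j => ?_) i
    · simp only [ht, ht', Fin.append_left, Function.comp_apply]
      exact hΘg (hb j)
    · simp only [ht, ht', Fin.append_right]
      exact hΘx j
  have htsub : range t ⊆ ecl (G ∪ range x) := by
    rintro _ ⟨i, rfl⟩
    refine Fin.addCases (fun j => ?_) (fun j => ?_) i
    · rw [ht, Fin.append_left]
      exact subset_ecl _ (Or.inl (hb j))
    · rw [ht, Fin.append_right]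
      exact subset_ecl _ (Or.inr ⟨j, rfl⟩)
  have hres := hΘ.restrict htsub
  have himg : Θ '' range t = range t' := by
    rw [← range_comp]
    exact congr_arg range (funext fun i => hΘt i)
  rw [himg] at hres
  let φ : ExponentialRingHom (Khovanskii.eclSubfield (range t)) K' :=
    (Khovanskii.eclSubfield.eHom (range t')).comp hres.equiv.toExponentialRingHom
  have hφ : ∀ z, φ z = Θ z := fun _ => rfl
  refine eqQFType₂_of_eHom φ ?_ (fun i => by rw [hφ]; exact hΘt i)
  ext w
  constructor
  · rintro ⟨z, rfl⟩
    rw [hφ]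
    exact hres.bijOn.mapsTo z.2
  · intro hw
    obtain ⟨z, hz, rfl⟩ := hres.bijOn.surjOn hw
    exact ⟨⟨z, hz⟩, hφ _⟩

/-- **Axiom (4ii) over closed sets, in isomorphism form**: along an isomorphism of closures
`Θ : ecl(G ∪ x̄) ≅ ecl(S')` extending `g` on `G` with `x̄ ↦ x̄'`, every `y ∈ ecl(G ∪ x̄)` has the
partner `Θ y`: `qftp(G, x̄, y) = qftp(g G, x̄', Θ y)` along `g`. [cite: Haykazyan2016, Definition 2]
[cite: Kirby2010QMEC, Thm 2.1] -/
theorem exists_eqQFTypeOver₂_snoc_of_isEIsoOn₂ {G : Set K} {S' : Set K'} {g Θ : K → K'} {n : ℕ}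
    {x : Fin n → K} {x' : Fin n → K'} (hΘ : IsEIsoOn₂ Θ (ecl (G ∪ range x)) (ecl S'))
    (hΘg : EqOn Θ g G) (hΘx : ∀ i, Θ (x i) = x' i) {y : K} (hy : y ∈ ecl (G ∪ range x)) :
    ∃ y' : K', Language.eclIso.EqQFTypeOver₂ G g (Fin.snoc x y : Fin (n + 1) → K) (Fin.snoc x' y') := by
  refine ⟨Θ y, eqQFTypeOver₂_of_isEIsoOn₂ (S' := S') ?_ hΘg fun i => ?_⟩
  · have heq : ecl (G ∪ range (Fin.snoc x y : Fin (n + 1) → K)) = ecl (G ∪ range x) := by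
      have h1 : G ∪ range (Fin.snoc x y : Fin (n + 1) → K) = insert y (G ∪ range x) := by
        ext z
        simp only [mem_union, mem_range, mem_insert_iff]
        constructor
        · rintro (hz | ⟨i, rfl⟩)
          · exact Or.inr (Or.inl hz)
          · refine Fin.lastCases ?_ (fun j => ?_) i
            · exact Or.inl (by simp)
            · exact Or.inr (Or.inr ⟨j, by simp⟩)
        · rintro (rfl | hz | ⟨i, rfl⟩)
          · exact Or.inr ⟨Fin.last n, by simp⟩
          · exact Or.inl hz
          · exact Or.inr ⟨Fin.castSucc i, by simp⟩
      rw [h1, ecl_insert_of_mem hy]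
    rwa [heq]
  · refine Fin.lastCases ?_ (fun j => ?_) i
    · simp
    · simp [hΘx j]

end OverClosed

/-! ### Axiom (4i) over countable closed subsets for the class of Zilber fields -/

section ClassAxiom

variable {H H' : Type} [Language.eclIso.Structure H] [Language.eclIso.Structure H']
  {cl : Set H → Set H} {cl' : Set H' → Set H'}

/-- **Axiom (4i) over countable closed subsets, across two Zilber fields** — hypothesis `h₄₃` of
`ZilberClass.isQuasiminimalPregeometryClass_of`: for `⟨H, cl⟩, ⟨H', cl'⟩` in the class of Zilber
fields, `G ⊆ H` countable and closed, `g` a partial embedding on `G` with closed image, and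
`x ∉ cl G`, `x' ∉ cl' (g G)`, the quantifier-free types of `(G, x)` and `(g G, x')` along `g` agree.
Proof: `g` is an isomorphism of exponential fields `G ≅ g G` (`isEIsoOn₂_of_isPartialEmbOn`), which
extends with `x ↦ x'` to `ecl(G, x) ≅ ecl(g G, x')` by the cross-field Kirby 2010 Thm 2.1
(`IsZilberField.eclIso_extension₂`), whence the types (`eqQFTypeOver₂_of_isEIsoOn₂`).
[cite: Haykazyan2016, Definition 2] [cite: Kirby2010QMEC, Thm 2.1 and Prop. 3.5]
[cite: BaysKirby2013Excellence, Prop. 5 (i)] -/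
theorem ZilberClass.eqQFTypeOver₂_of_notMem_of_closed (hH : ZilberClass H cl) (hH' : ZilberClass H' cl')
    (G : Set H) (g : H → H') (hGc : G.Countable) (hG : cl G = G) (hG' : cl' (g '' G) = g '' G)
    (hg : IsPartialEmbOn Language.eclIso g G) ⦃x : H⦄ ⦃x' : H'⦄ (hx : x ∉ cl G) (hx' : x' ∉ cl' (g '' G)) :
    Language.eclIso.EqQFTypeOver₂ G g ![x] ![x'] := by
  obtain ⟨iF, iCZ, iE, hZ, rfl, rfl⟩ := hH
  obtain ⟨iF', iCZ', iE', hZ', rfl, rfl⟩ := hH'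
  -- `g` is an isomorphism of exponential fields `ecl G = G ≅ g G = ecl (g G)`
  have hgiso : IsEIsoOn₂ g (ecl G) (ecl (g '' G)) := by
    have := isEIsoOn₂_of_isPartialEmbOn hG hg
    rwa [hG, hG']
  obtain ⟨Θ, hΘ, hΘg, hΘx⟩ := IsZilberField.eclIso_extension₂ hZ hZ' hGc hgiso hx hx'
  refine eqQFTypeOver₂_of_isEIsoOn₂ (S' := insert x' (g '' G)) ?_ (fun z hz => hΘg (by rw [hG]; exact hz))
    fun i => ?_
  · have heq : G ∪ range ![x] = insert x G := by
      rw [Matrix.range_cons, Matrix.range_empty, union_empty, union_singleton]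
    rwa [heq]
  · rw [Fin.fin_one_eq_zero i]
    simpa using hΘx

end ClassAxiom

end Literature.NumberTheory.Transcendental

/-! ## Part II — from `ZilberHomogeneityLemmas` -/

/-! ### Matroid lemmas: transfer of bases and relative rank along independence-preserving maps -/

namespace Matroid

variable {α β : Type*} {M : Matroid α} {M' : Matroid β} {D : Set α} {Θ : α → β}

/-- **Bases transfer along independence-preserving maps**: if `I ⊆ D` is `M`-independent iff
`Θ I` is `M'`-independent, then the image of an `M`-basis of `X ⊆ D` is an `M'`-basis of `Θ X`.
[folklore] -/
theorem IsBasis'.image_of_forall_indep_iff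
    (hind : ∀ I ⊆ D, M.Indep I ↔ M'.Indep (Θ '' I)) {I X : Set α} (hX : X ⊆ D)
    (hI : M.IsBasis' I X) : M'.IsBasis' (Θ '' I) (Θ '' X) := by
  have hIX : I ⊆ X := hI.subset
  refine ⟨⟨(hind I (hIX.trans hX)).1 hI.indep, image_mono hIX⟩, ?_⟩
  rintro J' ⟨hJ'ind, hJ'X⟩ hIJ'
  -- pull `J'` back to `J = X ∩ Θ⁻¹ J'`
  set J : Set α := X ∩ Θ ⁻¹' J' with hJdef
  have hJimg : Θ '' J = J' := by
    ext y
    constructor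
    · rintro ⟨x, ⟨-, hx⟩, rfl⟩; exact hx
    · intro hy
      obtain ⟨x, hx, rfl⟩ := hJ'X hy
      exact ⟨x, ⟨hx, hy⟩, rfl⟩
  have hJind : M.Indep J := (hind J (inter_subset_left.trans hX)).2 (by rw [hJimg]; exact hJ'ind)
  have hIJ : I ⊆ J := fun i hi => ⟨hIX hi, show Θ i ∈ J' from hIJ' ⟨i, hi, rfl⟩⟩
  have hJI : J ⊆ I := hI.2 ⟨hJind, inter_subset_left⟩ hIJ
  rw [← hJimg]
  exact image_mono hJI

/-- **Relative rank transfers along independence-preserving injections**: if `Θ` is injective on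
`D` and preserves independence of subsets of `D` (in matroids whose ground sets are everything),
then `rk_M(X/C) = rk_{M'}(Θ X/Θ C)` for `C, X ⊆ D`. [folklore] -/
theorem relRank_image_eq (hinj : InjOn Θ D) (hind : ∀ I ⊆ D, M.Indep I ↔ M'.Indep (Θ '' I))
    {C X : Set α} (hC : C ⊆ D) (hX : X ⊆ D) :
    M.relRank C X = M'.relRank (Θ '' C) (Θ '' X) := by
  obtain ⟨B, hB⟩ := M.exists_isBasis' C
  have hB' : M'.IsBasis' (Θ '' B) (Θ '' C) := hB.image_of_forall_indep_iff hind hC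
  have hBD : B ⊆ D := hB.subset.trans hC
  -- independence in the contractions corresponds
  have hindC : ∀ I ⊆ D, (M ／ C).Indep I ↔ (M' ／ (Θ '' C)).Indep (Θ '' I) := by
    intro I hID
    rw [hB.contract_indep_iff, hB'.contract_indep_iff, ← image_union, hind _ (union_subset hID hBD)]
    refine and_congr_right fun _ => ⟨fun h => ?_, fun h => ?_⟩
    · refine disjoint_left.2 ?_
      rintro _ ⟨c, hc, rfl⟩ ⟨i, hi, hci⟩
      have : i = c := hinj (hID hi) (hC hc) hci
      exact disjoint_left.1 h hc (this ▸ hi)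
    · exact disjoint_left.2 fun c hc hi => disjoint_left.1 h (mem_image_of_mem Θ hc) (mem_image_of_mem Θ hi)
  obtain ⟨J, hJ⟩ := (M ／ C).exists_isBasis' X
  have hJ' : (M' ／ (Θ '' C)).IsBasis' (Θ '' J) (Θ '' X) :=
    hJ.image_of_forall_indep_iff (M := M ／ C) (M' := M' ／ (Θ '' C)) hindC hX
  rw [relRank_eq_eRk_contract, relRank_eq_eRk_contract, ← hJ.encard_eq_eRk, ← hJ'.encard_eq_eRk,
    (hinj.mono (hJ.subset.trans hX)).encard_image]

/-- **Independence transfer through the addition formula.** If `X₀` (finite, inside `D ⊇ C`) is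
independent over `C` and `Y` has the same finite relative rank over `D` as over `C`, then `X₀` is
independent over `C ∪ Y`: computing `rk(X₀ ∪ Y/C)` along `C ⊆ C ∪ X₀` and along `C ⊆ C ∪ Y`,
`|X₀| + rk(Y/C) = rk(Y/C) + rk(X₀/C ∪ Y)`. (The symmetry of independence in pregeometries, as used
in Bays–Kirby 2013, proof of Prop. 5: "`G` is `ecl`-independent over `G₀` from `d`".)
[cite: BaysKirby2013Excellence, Prop. 5 (proof)] -/
theorem contract_indep_union_of_relRank_eq (M : Matroid α) {C D' X₀ Y : Set α}
    (hX₀ : (M ／ C).Indep X₀) (hX₀fin : X₀.Finite) (hCD : C ⊆ D') (hX₀D : X₀ ⊆ D')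
    (hY : M.relRank C Y < ⊤) (hr : M.relRank D' Y = M.relRank C Y) : (M ／ (C ∪ Y)).Indep X₀ := by
  have h0 : M.relRank C X₀ = X₀.encard := (M.relRank_eq_encard_iff_contract_indep C hX₀fin).2 hX₀
  -- along `C ⊆ C ∪ X₀`
  have h1 := M.relRank_add_relRank' (subset_union_left : C ⊆ C ∪ X₀) Y
  rw [relRank_union_self_left, h0] at h1
  have hmid : M.relRank (C ∪ X₀) Y = M.relRank C Y := by
    refine le_antisymm (M.relRank_anti_left Y subset_union_left) ?_
    rw [← hr]
    exact M.relRank_anti_left Y (union_subset hCD hX₀D)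
  rw [hmid] at h1
  -- along `C ⊆ C ∪ Y`
  have h2 := M.relRank_add_relRank' (subset_union_left : C ⊆ C ∪ Y) X₀
  rw [relRank_union_self_left] at h2
  have hset : C ∪ Y ∪ X₀ = C ∪ X₀ ∪ Y := by
    rw [union_assoc, union_assoc, union_comm Y X₀]
  rw [hset, ← h1, add_comm (X₀.encard)] at h2
  have hne : M.relRank C Y ≠ ⊤ := hY.ne
  have h3 : M.relRank (C ∪ Y) X₀ = X₀.encard := (add_right_inj_of_ne_top hne).1 h2
  exact (M.relRank_eq_encard_iff_contract_indep (C ∪ Y) hX₀fin).1 h3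

end Matroid

namespace Literature.NumberTheory.Transcendental

open GammaField Literature.ModelTheory.ExponentialFields.ExponentialRing
  Literature.ModelTheory.Quasiminimal

/-! ### `ℚ`-linearity of isomorphisms of closed sets -/

section Linear

variable {K : Type*} [Field K] [Literature.ModelTheory.ExponentialFields.ExponentialRing K]
variable {K' : Type*} [Field K'] [Literature.ModelTheory.ExponentialFields.ExponentialRing K']
variable {g : K → K'} {S : Set K} {S' : Set K'}

/-- An E-isomorphism `ecl S ≅ ecl S'` fixes the rationals. [folklore] -/
theorem IsEIsoOn₂.map_ratCast (h : IsEIsoOn₂ g (ecl S) (ecl S')) (q : ℚ) : g (q : K) = q := by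
  have h1 := _root_.map_ratCast h.equiv.toRingEquiv q
  have h2 : ((q : Khovanskii.eclSubfield S) : K) = q := rfl
  have h3 : ((q : Khovanskii.eclSubfield S') : K') = q := rfl
  have h4 : (h.equiv.toRingEquiv (q : Khovanskii.eclSubfield S) : K') = g (q : K) := rfl
  rw [← h3, ← h1, h4]

omit [Literature.ModelTheory.ExponentialFields.ExponentialRing K'] in
/-- `ecl S` is closed under rational scalars. [folklore] -/
theorem smul_mem_ecl (q : ℚ) {v : K} (hv : v ∈ ecl S) : q • v ∈ ecl S := by
  rw [Rat.smul_def]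
  exact Khovanskii.mul_mem_ecl (SubfieldClass.ratCast_mem (Khovanskii.eclSubfield S) q) hv

omit [Literature.ModelTheory.ExponentialFields.ExponentialRing K'] in
/-- `ecl S` is closed under rational linear combinations. [folklore] -/
theorem sum_smul_mem_ecl {m : ℕ} (q : Fin m → ℚ) {v : Fin m → K} (hv : ∀ i, v i ∈ ecl S)
    (s : Finset (Fin m)) : (∑ j ∈ s, q j • v j) ∈ ecl S :=
  (Khovanskii.eclSubfield S).sum_mem fun j _ => smul_mem_ecl (q j) (hv j)

/-- An E-isomorphism `ecl S ≅ ecl S'` is `ℚ`-homogeneous on `ecl S`. [folklore] -/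
theorem IsEIsoOn₂.map_smul_of_mem (h : IsEIsoOn₂ g (ecl S) (ecl S')) (q : ℚ) {v : K} (hv : v ∈ ecl S) :
    g (q • v) = q • g v := by
  rw [Rat.smul_def, Rat.smul_def, h.map_mul (SubfieldClass.ratCast_mem (Khovanskii.eclSubfield S) q) hv,
    h.map_ratCast]

/-- An E-isomorphism `ecl S ≅ ecl S'` maps `ℚ`-linear combinations of elements of `ecl S` to the
corresponding combinations. [folklore] -/
theorem IsEIsoOn₂.map_sum_smul (h : IsEIsoOn₂ g (ecl S) (ecl S')) {m : ℕ} (q : Fin m → ℚ)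
    {v : Fin m → K} (hv : ∀ i, v i ∈ ecl S) : g (∑ i, q i • v i) = ∑ i, q i • g (v i) := by
  classical
  induction (Finset.univ : Finset (Fin m)) using Finset.induction_on with
  | empty => rw [Finset.sum_empty, Finset.sum_empty, h.map_zero]
  | insert i s hi ih =>
    rw [Finset.sum_insert hi, Finset.sum_insert hi,
      h.map_add (smul_mem_ecl (q i) (hv i)) (sum_smul_mem_ecl q hv s), h.map_smul_of_mem (q i) (hv i), ih]

/-- An E-isomorphism `ecl S ≅ ecl S'` maps `κ + ∑ qᵢ vᵢ ↦ g κ + ∑ qᵢ g vᵢ`. [folklore] -/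
theorem IsEIsoOn₂.map_add_sum_smul (h : IsEIsoOn₂ g (ecl S) (ecl S')) {κ : K} (hκ : κ ∈ ecl S)
    {m : ℕ} (q : Fin m → ℚ) {v : Fin m → K} (hv : ∀ i, v i ∈ ecl S) :
    g (κ + ∑ i, q i • v i) = g κ + ∑ i, q i • g (v i) := by
  rw [h.map_add hκ (sum_smul_mem_ecl q hv _), h.map_sum_smul q hv]

end Linear

/-! ### Relative dimensions are preserved by isomorphisms of closed sets -/

section RelRank

variable {K : Type u} [Field K] [CharZero K] [Literature.ModelTheory.ExponentialFields.ExponentialRing K]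
variable {K' : Type u} [Field K'] [CharZero K'] [Literature.ModelTheory.ExponentialFields.ExponentialRing K']
variable {Θ : K → K'} {S : Set K} {S' : Set K'}

omit [CharZero K] [CharZero K'] in
/-- Under an E-isomorphism `Θ : ecl S ≅ ecl S'`, membership of `Θ e` in `Θ T` for `e ∈ ecl S`,
`T ⊆ ecl S` is membership of `e` in `T`. [folklore] -/
theorem IsEIsoOn₂.mem_image_iff (h : IsEIsoOn₂ Θ (ecl S) (ecl S')) {e : K} (he : e ∈ ecl S)
    {T : Set K} (hT : T ⊆ ecl S) : Θ e ∈ Θ '' T ↔ e ∈ T := by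
  constructor
  · rintro ⟨t, ht, hte⟩
    rwa [← h.bijOn.injOn (hT ht) he hte]
  · exact fun h' => mem_image_of_mem Θ h'

omit [CharZero K] [CharZero K'] in
/-- **`ecl`-independence is preserved**: for `I ⊆ ecl S`, `I` is `ecl`-independent in `K` iff
`Θ I` is `ecl`-independent in `K'`. [cite: Kirby2010QMEC, Lemma 1.3] -/
theorem IsEIsoOn₂.eclIndep_image_iff (h : IsEIsoOn₂ Θ (ecl S) (ecl S')) {I : Set K} (hI : I ⊆ ecl S) :
    (isPregeometry_ecl K).matroid.Indep I ↔ (isPregeometry_ecl K').matroid.Indep (Θ '' I) := by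
  rw [IsPregeometry.matroid_indep_iff, IsPregeometry.matroid_indep_iff]
  constructor
  · rintro hind _ ⟨e, he, rfl⟩ hecl
    have hdiff : Θ '' I \ {Θ e} = Θ '' (I \ {e}) := by
      ext y
      constructor
      · rintro ⟨⟨x, hx, rfl⟩, hne⟩
        exact ⟨x, ⟨hx, fun hxe => hne (by rw [mem_singleton_iff.1 hxe]; exact mem_singleton _)⟩, rfl⟩
      · rintro ⟨x, ⟨hx, hxe⟩, rfl⟩
        refine ⟨⟨x, hx, rfl⟩, fun hxe' => hxe ?_⟩
        exact h.bijOn.injOn (hI hx) (hI he) (mem_singleton_iff.1 hxe')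
    rw [hdiff, ← h.image_ecl (sdiff_subset.trans hI),
      h.mem_image_iff (hI he) (ecl_subset_ecl_of_subset (sdiff_subset.trans hI))] at hecl
    exact hind he hecl
  · intro hind e he hecl
    refine hind (mem_image_of_mem Θ he) ?_
    have hdiff : Θ '' (I \ {e}) ⊆ Θ '' I \ {Θ e} := by
      rintro _ ⟨x, ⟨hx, hxe⟩, rfl⟩
      exact ⟨⟨x, hx, rfl⟩, fun hxe' => hxe (h.bijOn.injOn (hI hx) (hI he) (mem_singleton_iff.1 hxe'))⟩
    refine ecl_mono hdiff ?_
    rw [← h.image_ecl (sdiff_subset.trans hI)]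
    exact mem_image_of_mem Θ hecl

omit [CharZero K] [CharZero K'] in
/-- **Relative `ecl`-dimension is preserved**: `dim_ecl(X/C) = dim_ecl(Θ X/Θ C)` for `C, X ⊆ ecl S`.
[cite: Kirby2010QMEC, Lemma 1.3] -/
theorem IsEIsoOn₂.relRank_ecl_image_eq (h : IsEIsoOn₂ Θ (ecl S) (ecl S')) {C X : Set K}
    (hC : C ⊆ ecl S) (hX : X ⊆ ecl S) :
    (isPregeometry_ecl K).matroid.relRank C X =
      (isPregeometry_ecl K').matroid.relRank (Θ '' C) (Θ '' X) :=
  Matroid.relRank_image_eq h.bijOn.injOn (fun _ hI => h.eclIndep_image_iff hI) hC hX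

/-- **Algebraic independence is preserved**: for `I ⊆ ecl S`, `I` is algebraically independent
over `ℚ` in `K` iff `Θ I` is in `K'` (`Θ` restricts to a field isomorphism `ecl S ≅ ecl S'`).
[folklore] -/
theorem IsEIsoOn₂.algIndep_image_iff (h : IsEIsoOn₂ Θ (ecl S) (ecl S')) {I : Set K} (hI : I ⊆ ecl S) :
    (algMatroid K).Indep I ↔ (algMatroid K').Indep (Θ '' I) := by
  rw [AlgebraicIndependent.matroid_indep_iff, AlgebraicIndependent.matroid_indep_iff]
  change AlgebraicIndependent ℚ (fun i : I => (i : K)) ↔ AlgebraicIndependent ℚ (fun i : Θ '' I => (i : K'))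
  -- the family inside the E-subfield `ecl S`
  let v₀ : I → Khovanskii.eclSubfield S := fun i => ⟨i, hI i.2⟩
  have hsub : ∀ a b : ℚ →+* K, a = b := fun a b => Subsingleton.elim a b
  have h1 : AlgebraicIndependent ℚ (fun i : I => (i : K)) ↔ AlgebraicIndependent ℚ v₀ := by
    have := algebraicIndependent_ringHom_iff_of_comp_eq (RingEquiv.refl ℚ)
      (Khovanskii.eclSubfield S).subtype (x := v₀) (Khovanskii.eclSubfield S).subtype_injective
      (Subsingleton.elim _ _)
    exact this
  have h2 : AlgebraicIndependent ℚ v₀ ↔ AlgebraicIndependent ℚ (fun i : I => Θ (i : K)) := by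
    have hinj : Function.Injective ((Khovanskii.eclSubfield S').subtype.comp h.equiv.toRingEquiv.toRingHom) :=
      (Khovanskii.eclSubfield S').subtype_injective.comp h.equiv.toRingEquiv.injective
    have := algebraicIndependent_ringHom_iff_of_comp_eq (RingEquiv.refl ℚ)
      ((Khovanskii.eclSubfield S').subtype.comp h.equiv.toRingEquiv.toRingHom) (x := v₀) hinj
      (Subsingleton.elim _ _)
    exact this.symm
  have h3 : AlgebraicIndependent ℚ (fun i : I => Θ (i : K)) ↔
      AlgebraicIndependent ℚ (fun i : Θ '' I => (i : K')) := by
    have hinj : Function.Injective (fun i : I => Θ (i : K)) := fun a b hab =>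
      Subtype.ext (h.bijOn.injOn (hI a.2) (hI b.2) hab)
    rw [← algebraicIndependent_subtype_range hinj]
    have hr : range (fun i : I => Θ (i : K)) = Θ '' I := by
      rw [image_eq_range]
    rw [hr]
  exact h1.trans (h2.trans h3)

/-- **Relative transcendence degree is preserved**: `td(X/C) = td(Θ X/Θ C)` for `C, X ⊆ ecl S`
(relative ranks in the algebraic matroids of `K`, `K'`). [folklore] -/
theorem IsEIsoOn₂.relRank_alg_image_eq (h : IsEIsoOn₂ Θ (ecl S) (ecl S')) {C X : Set K}
    (hC : C ⊆ ecl S) (hX : X ⊆ ecl S) :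
    (algMatroid K).relRank C X = (algMatroid K').relRank (Θ '' C) (Θ '' X) :=
  Matroid.relRank_image_eq h.bijOn.injOn (fun _ hI => h.algIndep_image_iff hI) hC hX

end RelRank

/-! ### Descent of cross Γ-isomorphisms to smaller bases -/

namespace GammaField

variable {F₁ : Type u} [Field F₁] [CharZero F₁] [Literature.ModelTheory.ExponentialFields.ExponentialRing F₁]
variable {F₂ : Type u} [Field F₂] [CharZero F₂] [Literature.ModelTheory.ExponentialFields.ExponentialRing F₂]

/-- **Descent of the base**: a cross Γ-isomorphism `c ↦ c'` over an isomorphism `Σ` of base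
Γ-fields `Ψ : L₁⁰ ≅ L₂⁰` is a cross Γ-isomorphism over any `σ : K₁⁰ ≅ K₂⁰` with `K₁⁰ ⊆ L₁⁰` on which
`Ψ` restricts to `σ` (polynomials over `K₁⁰` are polynomials over `L₁⁰`). [folklore] -/
theorem IsGammaIsoTw₂.of_base_le {L₁ : Submodule ℚ F₁} {L₂ : Submodule ℚ F₂} {Ψ : fieldOf L₁ ≃+* fieldOf L₂}
    {K₁ : Submodule ℚ F₁} {K₂ : Submodule ℚ F₂} {σ : fieldOf K₁ ≃+* fieldOf K₂}
    (ι : fieldOf K₁ →+* fieldOf L₁) (hι : ∀ k, (ι k : F₁) = k) (hΨ : ∀ k, (Ψ (ι k) : F₂) = σ k)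
    {N : ℕ} {c : Fin N → F₁} {c' : Fin N → F₂} (h : IsGammaIsoTw₂ Ψ c c') : IsGammaIsoTw₂ σ c c' := by
  intro M P
  have key := h M (MvPolynomial.map ι P)
  have e1 : MvPolynomial.aeval (lvGens M c) (MvPolynomial.map ι P) = MvPolynomial.aeval (lvGens M c) P := by
    rw [MvPolynomial.aeval_def, MvPolynomial.aeval_def, MvPolynomial.eval₂_map]
    congr 1
    exact RingHom.ext fun k => hι k
  have e2 : MvPolynomial.aeval (lvGens M c')
        (MvPolynomial.map (Ψ : fieldOf L₁ →+* fieldOf L₂) (MvPolynomial.map ι P)) =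
      MvPolynomial.aeval (lvGens M c') (MvPolynomial.map (σ : fieldOf K₁ →+* fieldOf K₂) P) := by
    rw [MvPolynomial.aeval_def, MvPolynomial.aeval_def, MvPolynomial.map_map, MvPolynomial.eval₂_map,
      MvPolynomial.eval₂_map]
    congr 1
    exact RingHom.ext fun k => hΨ k
  rw [e1, e2] at key
  exact key

/-- **Descent of the base, set-theoretic form**: a cross Γ-isomorphism `c ↦ c'` over an
isomorphism `Ψ` of base Γ-fields `L₁⁰ ≅ L₂⁰` is a cross Γ-isomorphism over any `σ : K₁⁰ ≅ K₂⁰` with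
`K₁⁰ ⊆ L₁⁰` (as sets) on which `Ψ` restricts to `σ`: a polynomial over `K₁⁰` is lifted
coefficientwise to `L₁⁰`. (No ring homomorphism `K₁⁰ → L₁⁰` is formed.) [folklore] -/
theorem IsGammaIsoTw₂.of_base_subset {L₁ K₁ : Submodule ℚ F₁} {L₂ K₂ : Submodule ℚ F₂}
    (hKL : (fieldOf K₁ : Set F₁) ⊆ fieldOf L₁) {Ψ : fieldOf L₁ ≃+* fieldOf L₂} {σ : fieldOf K₁ ≃+* fieldOf K₂}
    (hΨ : ∀ (z : F₁) (hz : z ∈ fieldOf K₁), (Ψ ⟨z, hKL hz⟩ : F₂) = σ ⟨z, hz⟩)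
    {N : ℕ} {c : Fin N → F₁} {c' : Fin N → F₂} (h : IsGammaIsoTw₂ Ψ c c') : IsGammaIsoTw₂ σ c c' := by
  classical
  intro M P
  have hcoef : ∀ m, ((P.coeff m : fieldOf K₁) : F₁) ∈ fieldOf L₁ := fun m => hKL (P.coeff m).2
  let Pt : MvPolynomial (Fin N ⊕ Fin N) (fieldOf L₁) :=
    ∑ m ∈ P.support, MvPolynomial.monomial m ⟨_, hcoef m⟩
  have hPt : ∀ m, ((Pt.coeff m : fieldOf L₁) : F₁) = ((P.coeff m : fieldOf K₁) : F₁) := by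
    intro m
    simp only [Pt, MvPolynomial.coeff_sum, MvPolynomial.coeff_monomial]
    by_cases hm : m ∈ P.support
    · rw [Finset.sum_eq_single m]
      · simp
      · intro b _ hb; rw [if_neg hb]
      · intro h'; exact absurd hm h'
    · rw [Finset.sum_eq_zero]
      · rw [MvPolynomial.notMem_support_iff.1 hm]; simp
      · intro b hb; rw [if_neg]; rintro rfl; exact hm hb
  have hsupp : Pt.support = P.support := by
    ext m
    rw [MvPolynomial.mem_support_iff, MvPolynomial.mem_support_iff, not_iff_not]
    constructor
    · intro h0
      have := hPt m
      rw [h0] at this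
      exact (map_eq_zero_iff _ (algebraMap (fieldOf K₁) F₁).injective).1 this.symm
    · intro h0
      apply Subtype.ext
      rw [hPt m, h0]; rfl
  have e1 : MvPolynomial.aeval (lvGens M c) P = MvPolynomial.aeval (lvGens M c) Pt := by
    rw [MvPolynomial.aeval_def, MvPolynomial.aeval_def, MvPolynomial.eval₂_eq, MvPolynomial.eval₂_eq, hsupp]
    refine Finset.sum_congr rfl fun m _ => ?_
    congr 1
    exact (hPt m).symm
  have e2 : MvPolynomial.aeval (lvGens M c') (MvPolynomial.map (σ : fieldOf K₁ →+* fieldOf K₂) P) =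
      MvPolynomial.aeval (lvGens M c') (MvPolynomial.map (Ψ : fieldOf L₁ →+* fieldOf L₂) Pt) := by
    rw [MvPolynomial.aeval_def, MvPolynomial.aeval_def, MvPolynomial.eval₂_map, MvPolynomial.eval₂_map,
      MvPolynomial.eval₂_eq, MvPolynomial.eval₂_eq, hsupp]
    refine Finset.sum_congr rfl fun m _ => ?_
    congr 1
    have hc : Pt.coeff m = ⟨((P.coeff m : fieldOf K₁) : F₁), hcoef m⟩ := Subtype.ext (hPt m)
    simp only [RingHom.coe_comp, Function.comp_apply]
    rw [hc]
    change ((σ (P.coeff m) : fieldOf K₂) : F₂) = ((Ψ ⟨((P.coeff m : fieldOf K₁) : F₁), hcoef m⟩ : fieldOf L₂) : F₂)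
    rw [hΨ _ (P.coeff m).2]
  rw [e1, e2]
  exact h M Pt

end GammaField

end Literature.NumberTheory.Transcendental

/-! ## Part III — from `ZilberLevelZeroGenericity` -/

open MvPolynomial

namespace Literature.NumberTheory.Transcendental

namespace GammaField

open Literature.ModelTheory.ExponentialFields.ExponentialRing ZilberSaturationMain ZilberPrimeModel
  Literature.FieldTheory.Kummer

variable {K : Type u} [Field K] [CharZero K] [Literature.ModelTheory.ExponentialFields.ExponentialRing K]
variable {K' : Type u} [Field K'] [CharZero K'] [Literature.ModelTheory.ExponentialFields.ExponentialRing K']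

/-! ### The level-`0` Γ-field over a Γ-closed base is relatively algebraically closed -/

/-- The level-`0` field `⟨K₂ ∅⟩` of the empty tuple is the image of `K₂⁰`: its elements lie in
`acl (gens K₂)`. [folklore] -/
theorem coe_bfld_elim0_subset_acl (K₂ : Submodule ℚ K) :
    ((bfld K₂ (Fin.elim0 : Fin 0 → K) : IntermediateField (fieldOf K₂) K) : Set K) ⊆ acl (gens K₂) := by
  have := coe_bfld_subset_acl K₂ (Fin.elim0 : Fin 0 → K)
  rwa [Set.range_eq_empty, Submodule.span_empty, sup_bot_eq] at this

/-- Over a Γ-closed `K₂`, `⟨K₂ ∅⟩` is relatively algebraically closed in every `⟨K₂ ∅⟩(u, exp u)`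
(algebraic elements over `K₂⁰` lie in `K₂`, `IsGammaClosed.mem_of_mem_acl`). [cite: BaysKirby2018ANT, Def. 4.9, Lemma 4.10] -/
theorem rac_bfld_elim0 {K₂ : Submodule ℚ K} (hK₂ : IsGammaClosed K₂) {n : ℕ} (u : Fin n → K) :
    ∀ z ∈ IntermediateField.adjoin (fieldOf K₂) (allGens (Fin.elim0 : Fin 0 → K) ∪ range (gammaPt u)),
      IsAlgebraic (bfld K₂ (Fin.elim0 : Fin 0 → K)) z → z ∈ bfld K₂ (Fin.elim0 : Fin 0 → K) := by
  intro z _ halg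
  have hz : z ∈ acl ((bfld K₂ (Fin.elim0 : Fin 0 → K) : IntermediateField (fieldOf K₂) K) : Set K) :=
    mem_acl_coe_of_isAlgebraic _ halg
  have hz' : z ∈ acl (gens K₂) := by
    have := acl_mono (coe_bfld_elim0_subset_acl K₂) hz
    rwa [acl_acl] at this
  have hzK : z ∈ K₂ := hK₂.mem_of_mem_acl hz'
  exact IntermediateField.algebraMap_mem _ (⟨z, mem_fieldOf_of_mem hzK⟩ : fieldOf K₂)

/-- Over a Γ-closed `K₂`, no non-trivial `ℤ`-combination of a tuple linearly independent over `K₂`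
has its exponential in `⟨K₂ ∅⟩` (logarithms of elements algebraic over `K₂⁰` lie in `K₂`,
`IsGammaClosed.mem_of_exp_mem_acl`). [cite: BaysKirby2018ANT, Lemma 4.10] -/
theorem mul_bfld_elim0 {K₂ : Submodule ℚ K} (hK₂ : IsGammaClosed K₂) {n : ℕ} {u : Fin n → K}
    (hu : LinIndepOver K₂ u) :
    ∀ w : Fin n → ℤ, exp (∑ j, (w j : ℚ) • u j) ∈
      IntermediateField.adjoin (fieldOf K₂) (allGens (Fin.elim0 : Fin 0 → K)) → w = 0 := by
  intro w hw
  by_contra hw0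
  have hmem : exp (∑ j, (w j : ℚ) • u j) ∈ acl (gens K₂) := coe_bfld_elim0_subset_acl K₂ hw
  exact hu.sum_intCast_smul_notMem hw0 (hK₂.mem_of_exp_mem_acl hmem)

/-! ### Normalised strong hulls over a Γ-closed base -/

/-- **Normalised strong hulls over a Γ-closed base.** Let `K₂` be Γ-closed in the algebraically
closed `K` and `w` a finite tuple. Then there is a tuple `d`, linearly independent over `K₂`, with
`K₂ + ℚd ◁ K`, `w ⊆ K₂ + ℚd ⊆ span ecl(K₂ ∪ w)`, and `exp d₁, …, exp d_N` Kummer-independent in the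
level-`0` field `K₂⁰(d, exp d)` for every exponent: the hull of `K₂ + ℚw` inside the Γ-closed
`span ecl(K₂ ∪ w)` (`IsStrong.exists_isStrong_of_le`, Bays–Kirby 2018 Def. 4.6), a `K₂`-basis of it,
normalised by `exists_relative_normalised_basis` (Bays–Kirby 2018 Prop. 3.24; the relative
algebraic closedness and the multiplicative condition hold over a Γ-closed base,
`rac_bfld_elim0`, `mul_bfld_elim0`). [cite: BaysKirby2018ANT, Def. 4.6, Prop. 3.24]
[cite: BaysKirby2013Excellence, Prop. 5 (proof: "we may assume `⟨Gd⟩ ◁ B` … Kummer-generic")] -/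
theorem exists_normalised_hull [IsAlgClosed K] {K₂ : Submodule ℚ K} (hK₂ : IsGammaClosed K₂)
    {m : ℕ} (w : Fin m → K) :
    ∃ (N : ℕ) (d : Fin N → K), LinIndepOver K₂ d ∧ IsStrong (K₂ ⊔ Submodule.span ℚ (range d)) ∧
      (∀ i, w i ∈ K₂ ⊔ Submodule.span ℚ (range d)) ∧
      (K₂ ⊔ Submodule.span ℚ (range d) ≤ Submodule.span ℚ (ecl ((K₂ : Set K) ∪ range w))) ∧
      ∀ m', 0 < m' → IndepModPowers m' (fun j =>
        (⟨exp (d j), IntermediateField.subset_adjoin _ _ (Or.inr ⟨Sum.inr j, rfl⟩)⟩ :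
          IntermediateField.adjoin (fieldOf K₂) (allGens (Fin.elim0 : Fin 0 → K) ∪ range (gammaPt d)))) := by
  classical
  set H : Submodule ℚ K := Submodule.span ℚ (ecl ((K₂ : Set K) ∪ range w)) with hHdef
  have hH : IsGammaClosed H := isGammaClosed_span_ecl_univ _
  have hK₂H : K₂ ≤ H := fun z hz => Submodule.subset_span (subset_ecl _ (Or.inl hz))
  have hwH : ∀ i, w i ∈ H := fun i => Submodule.subset_span (subset_ecl _ (Or.inr ⟨i, rfl⟩))
  have hΛ'H : K₂ ⊔ Submodule.span ℚ (range w) ≤ H :=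
    sup_le hK₂H (Submodule.span_le.2 (by rintro _ ⟨i, rfl⟩; exact hwH i))
  have hfg : IsFG K₂ (K₂ ⊔ Submodule.span ℚ (range w)) := isFG_sup_left.2 (isFG_span_of_finite _ (finite_range w))
  obtain ⟨E, hΛ'E, hEH, hfgE, hEstrong⟩ :=
    hK₂.isStrong.exists_isStrong_of_le hH.isStrong le_sup_left hΛ'H hfg
  have hK₂E : K₂ ≤ E := le_sup_left.trans hΛ'E
  -- generators and a `K₂`-basis of `E`
  obtain ⟨s, hsE, hEle⟩ := isFG_iff_exists_finset.1 hfgE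
  set u₀ : Fin s.card → K := fun i => (s.equivFin.symm i : K) with hu₀
  have hu₀E : ∀ i, u₀ i ∈ E := fun i => hsE (s.equivFin.symm i).2
  have hEeq : K₂ ⊔ Submodule.span ℚ (range u₀) = E := by
    refine le_antisymm (sup_le hK₂E (Submodule.span_le.2 (by rintro _ ⟨i, rfl⟩; exact hu₀E i))) ?_
    refine hEle.trans (sup_le le_sup_left ((Submodule.span_mono ?_).trans le_sup_right))
    intro z hz
    exact ⟨s.equivFin ⟨z, hz⟩, by simp [hu₀]⟩
  obtain ⟨N, ρ, hu, huspan⟩ := exists_linIndepOver_comp K₂ u₀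
  rw [hEeq] at huspan
  -- normalise
  obtain ⟨d, hdspan, hdint, -, hkum⟩ :=
    exists_relative_normalised_basis hK₂ (Fin.elim0 : Fin 0 → K) (mul_bfld_elim0 hK₂ hu) (rac_bfld_elim0 hK₂ (u₀ ∘ ρ))
  have hspan_eq : Submodule.span ℚ (range d) = Submodule.span ℚ (range (u₀ ∘ ρ)) := by
    refine le_antisymm (Submodule.span_le.2 ?_) (Submodule.span_le.2 ?_)
    · rintro _ ⟨j, rfl⟩; exact hdspan j
    · rintro _ ⟨i, rfl⟩
      obtain ⟨z, hz⟩ := hdint i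
      rw [SetLike.mem_coe, hz]
      exact Submodule.sum_mem _ fun j _ => Submodule.smul_mem _ _ (Submodule.subset_span ⟨j, rfl⟩)
  have hEd : K₂ ⊔ Submodule.span ℚ (range d) = E := by rw [hspan_eq, huspan]
  have hd : LinIndepOver K₂ d := hu.of_sup_span_eq (by rw [huspan, hEd])
  refine ⟨N, d, hd, by rw [hEd]; exact hEstrong, fun i => ?_, by rw [hEd]; exact hEH, hkum⟩
  rw [hEd]
  exact hΛ'E (Submodule.mem_sup_right (Submodule.subset_span ⟨i, rfl⟩))

/-! ### Zeros of the transported level-`0` ideal from an E-ring embedding -/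

/-- **Zeros of the transported level-`0` ideal.** Let `σ : K₂⁰ ≅ K₂'⁰`, `d` a tuple of `K`, and
`φ : ecl L → K'` an embedding of exponential rings (`L ⊆ K`) with `d ⊆ ecl L`, `φ d = d'`. If the
level-`0` locus ideal of `(d, exp d)` over `K₂⁰` is generated by finitely many polynomials all of
whose coefficients lie in `ecl L` and are mapped by `φ` as by `σ`, then `(d', exp d')` is a zero of
the `σ`-transported ideal. (Evaluation of the generators commutes with `φ`.)
[cite: BaysKirby2013Excellence, Prop. 5 (proof: "`V` is over `G₀`")] -/
theorem gammaPt_mem_zeroLocus_locusIdealTw₂_of_eHom {K₂ : Submodule ℚ K} {K₂' : Submodule ℚ K'}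
    (σ : fieldOf K₂ ≃+* fieldOf K₂') {N : ℕ} {d : Fin N → K} {d' : Fin N → K'} {L : Set K}
    (φ : Literature.ModelTheory.ExponentialFields.ExponentialRingHom (Khovanskii.eclSubfield L) K')
    (hd : ∀ j, d j ∈ ecl L) (hd' : ∀ j, φ ⟨d j, hd j⟩ = d' j)
    (gs : Finset (MvPolynomial (Fin N ⊕ Fin N) (bfld K₂ (Fin.elim0 : Fin 0 → K))))
    (hgs : Ideal.span (gs : Set (MvPolynomial (Fin N ⊕ Fin N) (bfld K₂ (Fin.elim0 : Fin 0 → K)))) =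
      locusIdeal K₂ (Fin.elim0 : Fin 0 → K) d)
    (hcoef : ∀ p ∈ gs, ∀ mo ∈ p.support, ∃ hc : ((p.coeff mo : bfld K₂ (Fin.elim0 : Fin 0 → K)) : K) ∈ ecl L,
      φ ⟨_, hc⟩ = ((isGammaIsoTw₂_elim0 (K := K) (K' := K') σ).fieldEquiv (p.coeff mo) : K')) :
    gammaPt d' ∈ MvPolynomial.zeroLocus K'
      (locusIdealTw₂ (isGammaIsoTw₂_elim0 (K := K) (K' := K') σ) d) := by
  classical
  set hiso₀ := isGammaIsoTw₂_elim0 (K := K) (K' := K') σ with hiso₀def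
  set θ := hiso₀.fieldEquiv with hθ
  rw [MvPolynomial.mem_zeroLocus_iff]
  -- it suffices to check the images of the generators
  have hI' : locusIdealTw₂ hiso₀ d =
      Ideal.span ((fun p => MvPolynomial.map (θ : bfld K₂ (Fin.elim0 : Fin 0 → K) →+*
        bfld K₂' (Fin.elim0 : Fin 0 → K')) p) '' (gs : Set _)) := by
    rw [locusIdealTw₂, LocusComponents.idealMapCoeff, ← hgs, Ideal.map_span]
    rfl
  suffices hgen : ∀ p ∈ gs, aeval (gammaPt d')
      (MvPolynomial.map (θ : bfld K₂ (Fin.elim0 : Fin 0 → K) →+* bfld K₂' (Fin.elim0 : Fin 0 → K')) p) = 0 by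
    intro f hf
    rw [hI'] at hf
    refine Submodule.span_induction ?_ ?_ ?_ ?_ hf
    · rintro _ ⟨p, hp, rfl⟩; exact hgen p hp
    · exact map_zero _
    · intro x y _ _ hx hy; rw [map_add, hx, hy, add_zero]
    · intro a x _ hx; rw [smul_eq_mul, map_mul, hx, mul_zero]
  intro p hp
  -- the point `(d, exp d)` inside the E-subfield `ecl L`
  let dL : Fin N → Khovanskii.eclSubfield L := fun j => ⟨d j, hd j⟩
  have hγL : ∀ r, ((gammaPt dL r : Khovanskii.eclSubfield L) : K) = gammaPt d r := by
    rintro (j | j)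
    · rfl
    · rfl
  have hφγ : ∀ r, φ (gammaPt dL r) = gammaPt d' r := by
    rintro (j | j)
    · rw [gammaPt_inl, gammaPt_inl]; exact hd' j
    · rw [gammaPt_inr, gammaPt_inr, φ.map_exp, hd' j]
  -- lift `p` to a polynomial over `ecl L`
  have hcmem : ∀ mo, ((p.coeff mo : bfld K₂ (Fin.elim0 : Fin 0 → K)) : K) ∈ ecl L := by
    intro mo
    by_cases hmo : mo ∈ p.support
    · exact (hcoef p hp mo hmo).1
    · rw [MvPolynomial.notMem_support_iff.1 hmo]
      exact Khovanskii.zero_mem_ecl L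
  let pL : MvPolynomial (Fin N ⊕ Fin N) (Khovanskii.eclSubfield L) :=
    ∑ mo ∈ p.support, MvPolynomial.monomial mo ⟨_, hcmem mo⟩
  have hpLcoeff : ∀ mo, ((pL.coeff mo : Khovanskii.eclSubfield L) : K) =
      ((p.coeff mo : bfld K₂ (Fin.elim0 : Fin 0 → K)) : K) := by
    intro mo
    simp only [pL, MvPolynomial.coeff_sum, MvPolynomial.coeff_monomial]
    by_cases hmo : mo ∈ p.support
    · rw [Finset.sum_eq_single mo]
      · simp
      · intro b _ hb; rw [if_neg hb]
      · intro h; exact absurd hmo h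
    · rw [Finset.sum_eq_zero]
      · rw [MvPolynomial.notMem_support_iff.1 hmo]; simp
      · intro b hb; rw [if_neg]; rintro rfl; exact hmo hb
  -- `p(d, exp d) = 0`, computed inside `ecl L`
  have hp0 : aeval (gammaPt d) p = 0 := by
    rw [(isGenericPt_locusIdeal K₂ (Fin.elim0 : Fin 0 → K) d p)]
    rw [← hgs]; exact Ideal.subset_span hp
  have hpL0 : aeval (gammaPt dL) pL = 0 := by
    apply (Khovanskii.eclSubfield L).subtype_injective
    rw [map_zero]
    have e1 : ((Khovanskii.eclSubfield L).subtype) (aeval (gammaPt dL) pL) =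
        aeval (gammaPt d) (MvPolynomial.map (Khovanskii.eclSubfield L).subtype pL) := by
      rw [MvPolynomial.aeval_def, MvPolynomial.eval₂_comp_left, MvPolynomial.aeval_def, MvPolynomial.eval₂_map]
      congr 1
      funext r; exact hγL r
    rw [e1]
    have e2 : MvPolynomial.map (Khovanskii.eclSubfield L).subtype pL =
        MvPolynomial.map (algebraMap (bfld K₂ (Fin.elim0 : Fin 0 → K)) K) p := by
      ext mo
      rw [MvPolynomial.coeff_map, MvPolynomial.coeff_map]
      exact hpLcoeff mo
    rw [e2, MvPolynomial.aeval_map_algebraMap]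
    exact hp0
  -- apply `φ`
  have hφ0 : eval₂ φ.toRingHom (gammaPt d') pL = 0 := by
    have h1 : φ.toRingHom (aeval (gammaPt dL) pL) = 0 := by rw [hpL0, map_zero]
    rw [MvPolynomial.aeval_def, MvPolynomial.eval₂_comp_left] at h1
    have e3 : φ.toRingHom.comp (algebraMap (Khovanskii.eclSubfield L) (Khovanskii.eclSubfield L)) = φ.toRingHom :=
      RingHom.ext fun z => by simp
    have e4 : (⇑φ.toRingHom ∘ gammaPt dL) = gammaPt d' := funext fun r => hφγ r
    rwa [e3, e4] at h1
  -- compare with the transported generator, coefficientwise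
  rw [MvPolynomial.aeval_def, MvPolynomial.eval₂_map, MvPolynomial.eval₂_eq]
  rw [MvPolynomial.eval₂_eq] at hφ0
  have hsupp : pL.support = p.support := by
    ext mo
    rw [MvPolynomial.mem_support_iff, MvPolynomial.mem_support_iff, not_iff_not]
    constructor
    · intro h0
      have := hpLcoeff mo
      rw [h0] at this
      exact (map_eq_zero_iff _ (algebraMap (bfld K₂ (Fin.elim0 : Fin 0 → K)) K).injective).1 this.symm
    · intro h0
      apply Subtype.ext
      rw [hpLcoeff mo, h0]; rfl
  rw [hsupp] at hφ0
  rw [← hφ0]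
  refine Finset.sum_congr rfl fun mo hmo => ?_
  congr 1
  obtain ⟨hc, hφc⟩ := hcoef p hp mo hmo
  have hcL : pL.coeff mo = ⟨_, hc⟩ := Subtype.ext (hpLcoeff mo)
  simp only [RingHom.coe_comp, Function.comp_apply]
  rw [hcL]
  change (algebraMap (bfld K₂' (Fin.elim0 : Fin 0 → K')) K') (θ (p.coeff mo)) = φ ⟨_, hc⟩
  rw [hφc, IntermediateField.algebraMap_apply]

/-! ### Cross Γ-isomorphisms from level-`0` genericity -/

set_option maxHeartbeats 800000 in
/-- **Cross Γ-isomorphisms over a Γ-closed base from level-`0` genericity** (the Γ-field core of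
Bays–Kirby 2013, Prop. 5 (ii): "(d', exp d') is generic over `G` in `V`, so by Kummer-genericity of
`V` … `d' ≡_G d`", across two fields). Let `K₂` be Γ-closed in the algebraically closed `K`,
`σ : K₂⁰ ≅ K₂'⁰`, `d` a tuple of `K` with `exp d` Kummer-independent in `K₂⁰(d, exp d)`, and `d'` a
tuple of `K'`. If `(d', exp d')` is a zero of the `σ`-transport of the locus ideal of `(d, exp d)`
over `K₂⁰` and `td(d/K₂) ≤ td(d'/K₂')`, then `d ↦ d'` is a cross Γ-isomorphism over `σ` and
`td(d'/K₂') = td(d/K₂)`: the point is generic in the transported locus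
(`LocusComponents.isGenericPt_of_trdeg_le`), whence a level-`0` embedding over `σ`
(`pointFieldHom₂`) which Kummer genericity lifts to all levels
(`IsGammaIsoTw₂.append_of_ringHom_adjoin`). [cite: BaysKirby2013Excellence, Prop. 5 (proof), Lemma 3]
[cite: BaysKirby2018ANT, Prop. 3.22, Lemma 8.3 (proof)] -/
theorem isGammaIsoTw₂_of_mem_zeroLocus_of_td_le [IsAlgClosed K] [IsAlgClosed K'] {K₂ : Submodule ℚ K}
    {K₂' : Submodule ℚ K'} (hK₂ : IsGammaClosed K₂) (σ : fieldOf K₂ ≃+* fieldOf K₂') {N : ℕ}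
    {d : Fin N → K} {d' : Fin N → K'}
    (hkum : ∀ m, 0 < m → IndepModPowers m (fun j =>
      (⟨exp (d j), IntermediateField.subset_adjoin _ _ (Or.inr ⟨Sum.inr j, rfl⟩)⟩ :
        IntermediateField.adjoin (fieldOf K₂) (allGens (Fin.elim0 : Fin 0 → K) ∪ range (gammaPt d)))))
    (hz : gammaPt d' ∈ MvPolynomial.zeroLocus K'
      (locusIdealTw₂ (isGammaIsoTw₂_elim0 (K := K) (K' := K') σ) d))
    (htd : td K₂ (Submodule.span ℚ (range d)) ≤ td K₂' (Submodule.span ℚ (range d'))) :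
    IsGammaIsoTw₂ σ d d' ∧ td K₂' (Submodule.span ℚ (range d')) = td K₂ (Submodule.span ℚ (range d)) := by
  classical
  set hiso₀ := isGammaIsoTw₂_elim0 (K := K) (K' := K') σ with hiso₀def
  haveI hP' : (locusIdealTw₂ hiso₀ d).IsPrime := locusIdealTw₂_isPrime hiso₀ d
  have h0 : K₂ ⊔ Submodule.span ℚ (range (Fin.elim0 : Fin 0 → K)) = K₂ := by
    rw [Set.range_eq_empty, Submodule.span_empty, sup_bot_eq]
  have h0' : K₂' ⊔ Submodule.span ℚ (range (Fin.elim0 : Fin 0 → K')) = K₂' := by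
    rw [Set.range_eq_empty, Submodule.span_empty, sup_bot_eq]
  -- the dimensions
  have hfgd : IsFG K₂ (Submodule.span ℚ (range d)) := isFG_span_of_finite _ (finite_range d)
  set t : ℕ := (td K₂ (Submodule.span ℚ (range d))).toNat with htdef
  have ht : td K₂ (Submodule.span ℚ (range d)) = t := (ENat.coe_toNat (td_ne_top hfgd)).symm
  have htd₀ : td (K₂ ⊔ Submodule.span ℚ (range (Fin.elim0 : Fin 0 → K))) (Submodule.span ℚ (range d)) = t := by
    rw [h0]; exact ht
  have hdimP : ringKrullDim (zeroLocusCoordRing (locusIdeal K₂ (Fin.elim0 : Fin 0 → K) d)) = t :=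
    ringKrullDim_coordRing_locusIdeal_eq K₂ (Fin.elim0 : Fin 0 → K) d htd₀
  have hdimP' : ringKrullDim (zeroLocusCoordRing (locusIdealTw₂ hiso₀ d)) = t := by
    rw [locusIdealTw₂, LocusComponents.ringKrullDim_quotient_mapCoeff]; exact hdimP
  have htrP' : Algebra.trdeg (bfld K₂' (Fin.elim0 : Fin 0 → K')) (zeroLocusCoordRing (locusIdealTw₂ hiso₀ d)) = t := by
    have h1 := Literature.RingTheory.KrullDimension.ringKrullDim_eq_trdeg (bfld K₂' (Fin.elim0 : Fin 0 → K'))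
      (zeroLocusCoordRing (locusIdealTw₂ hiso₀ d))
    rw [hdimP'] at h1
    have h2 : Cardinal.toNat (Algebra.trdeg (bfld K₂' (Fin.elim0 : Fin 0 → K'))
        (zeroLocusCoordRing (locusIdealTw₂ hiso₀ d))) = t := by
      exact_mod_cast h1.symm
    rw [Literature.RingTheory.KrullDimension.trdeg_eq_toNat (bfld K₂' (Fin.elim0 : Fin 0 → K'))
      (zeroLocusCoordRing (locusIdealTw₂ hiso₀ d)), h2]
  have hrel : (algMatroid K').relRank (((bfld K₂' (Fin.elim0 : Fin 0 → K')).restrictScalars ℚ :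
      IntermediateField ℚ K') : Set K') (range (gammaPt d')) =
      td (K₂' ⊔ Submodule.span ℚ (range (Fin.elim0 : Fin 0 → K'))) (Submodule.span ℚ (range d')) :=
    relRank_range_gammaPt K₂' (Fin.elim0 : Fin 0 → K') d'
  have htd_ge : (t : ℕ∞) ≤ td (K₂' ⊔ Submodule.span ℚ (range (Fin.elim0 : Fin 0 → K')))
      (Submodule.span ℚ (range d')) := by
    rw [h0', ← ht]; exact htd
  -- genericity for dimension reasons
  have hgen : IsGenericPt (locusIdealTw₂ hiso₀ d) (gammaPt d') := by
    refine LocusComponents.isGenericPt_of_trdeg_le _ hz ?_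
    rw [htrP']
    refine Cardinal.natCast_le_toENat.1 ?_
    rw [toENat_trdeg_adjoin_bfld, hrel]
    exact htd_ge
  have htd_eq : td (K₂' ⊔ Submodule.span ℚ (range (Fin.elim0 : Fin 0 → K'))) (Submodule.span ℚ (range d')) = t := by
    refine le_antisymm ?_ htd_ge
    rw [← hrel, ← toENat_trdeg_adjoin_bfld, ← trdeg_coordRing_eq_of_isGenericPt hgen, htrP',
      Cardinal.toENat_nat]
  -- the level-`0` embedding over `σ`
  let σF : bfld K₂ (Fin.elim0 : Fin 0 → K) →+* K' :=
    (algebraMap (bfld K₂' (Fin.elim0 : Fin 0 → K')) K').comp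
      (hiso₀.fieldEquiv : bfld K₂ (Fin.elim0 : Fin 0 → K) →+* bfld K₂' (Fin.elim0 : Fin 0 → K'))
  have hiff : ∀ p : MvPolynomial (Fin N ⊕ Fin N) (bfld K₂ (Fin.elim0 : Fin 0 → K)),
      aeval (gammaPt d) p = 0 ↔ eval₂ σF (gammaPt d') p = 0 := by
    intro p
    have h1 : aeval (gammaPt d) p = 0 ↔
        MvPolynomial.map (hiso₀.fieldEquiv : bfld K₂ (Fin.elim0 : Fin 0 → K) →+*
          bfld K₂' (Fin.elim0 : Fin 0 → K')) p ∈ locusIdealTw₂ hiso₀ d := by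
      rw [mem_locusIdealTw₂_iff, MvPolynomial.map_map, RingEquiv.symm_comp, MvPolynomial.map_id]
    rw [h1, ← hgen, aeval_def, eval₂_map]
  let τ₂ := pointFieldHom₂ σF (gammaPt d) (gammaPt d') hiff
  have hmemΩ₂ : ∀ z : K, z ∈ IntermediateField.adjoin (fieldOf K₂) (allGens (Fin.elim0 : Fin 0 → K) ∪ range (gammaPt d)) →
      z ∈ IntermediateField.adjoin (bfld K₂ (Fin.elim0 : Fin 0 → K)) (range (gammaPt d)) := by
    intro z hz
    rw [← IntermediateField.mem_restrictScalars (fieldOf K₂), IntermediateField.adjoin_adjoin_left]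
    exact hz
  let jf : IntermediateField.adjoin (fieldOf K₂) (allGens (Fin.elim0 : Fin 0 → K) ∪ range (gammaPt d)) →+*
      IntermediateField.adjoin (bfld K₂ (Fin.elim0 : Fin 0 → K)) (range (gammaPt d)) :=
    { toFun := fun x => ⟨x, hmemΩ₂ x x.2⟩
      map_one' := Subtype.ext rfl
      map_mul' := fun _ _ => Subtype.ext rfl
      map_zero' := Subtype.ext rfl
      map_add' := fun _ _ => Subtype.ext rfl }
  let τ : IntermediateField.adjoin (fieldOf K₂) (allGens (Fin.elim0 : Fin 0 → K) ∪ range (gammaPt d)) →+* K' :=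
    τ₂.comp jf
  have hτE : ∀ (z : K) (hz : z ∈ IntermediateField.adjoin (fieldOf K₂) (allGens (Fin.elim0 : Fin 0 → K))),
      τ ⟨z, adjoinField_le_adjoin_union (Fin.elim0 : Fin 0 → K) d hz⟩ = (hiso₀.fieldEquiv ⟨z, hz⟩ : K') := by
    intro z hz
    have hj : jf ⟨z, adjoinField_le_adjoin_union (Fin.elim0 : Fin 0 → K) d hz⟩ =
        algebraMap (bfld K₂ (Fin.elim0 : Fin 0 → K))
          (IntermediateField.adjoin (bfld K₂ (Fin.elim0 : Fin 0 → K)) (range (gammaPt d))) ⟨z, hz⟩ :=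
      Subtype.ext (by rw [IntermediateField.coe_algebraMap_apply, IntermediateField.algebraMap_apply]; rfl)
    show τ₂ (jf ⟨z, _⟩) = _
    rw [hj, pointFieldHom₂_algebraMap]
    simp only [σF, RingHom.coe_comp, Function.comp_apply]
    rw [IntermediateField.algebraMap_apply]
    rfl
  have hτb : ∀ j, τ ⟨d j, IntermediateField.subset_adjoin _ _ (Or.inr ⟨Sum.inl j, rfl⟩)⟩ = d' j := by
    intro j
    have hj : jf ⟨d j, IntermediateField.subset_adjoin _ _ (Or.inr ⟨Sum.inl j, rfl⟩)⟩ =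
        ⟨gammaPt d (Sum.inl j), IntermediateField.subset_adjoin _ _ (mem_range_self _)⟩ := Subtype.ext rfl
    show τ₂ (jf ⟨d j, _⟩) = _
    rw [hj, pointFieldHom₂_apply_self, gammaPt_inl]
  have hτe : ∀ j, τ ⟨exp (d j), IntermediateField.subset_adjoin _ _ (Or.inr ⟨Sum.inr j, rfl⟩)⟩ = exp (d' j) := by
    intro j
    have hj : jf ⟨exp (d j), IntermediateField.subset_adjoin _ _ (Or.inr ⟨Sum.inr j, rfl⟩)⟩ =
        ⟨gammaPt d (Sum.inr j), IntermediateField.subset_adjoin _ _ (mem_range_self _)⟩ := Subtype.ext rfl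
    show τ₂ (jf ⟨exp (d j), _⟩) = _
    rw [hj, pointFieldHom₂_apply_self, gammaPt_inr]
  have hγ : IsGammaIsoTw₂ σ (Fin.append (Fin.elim0 : Fin 0 → K) d) (Fin.append (Fin.elim0 : Fin 0 → K') d') :=
    hiso₀.append_of_ringHom_adjoin hK₂ τ hτE hτb hτe hkum
  rw [Fin.elim0_append, Fin.elim0_append] at hγ
  have hγ' := hγ.comp (Fin.cast (Nat.zero_add N).symm)
  have e1 : (d ∘ Fin.cast (Nat.zero_add N)) ∘ Fin.cast (Nat.zero_add N).symm = d := by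
    funext i; exact congrArg d (Fin.ext rfl)
  have e2 : (d' ∘ Fin.cast (Nat.zero_add N)) ∘ Fin.cast (Nat.zero_add N).symm = d' := by
    funext i; exact congrArg d' (Fin.ext rfl)
  rw [e1, e2] at hγ'
  refine ⟨hγ', ?_⟩
  rw [h0'] at htd_eq
  rw [htd_eq, ht]

end GammaField

end Literature.NumberTheory.Transcendental

/-! ## Part IV — from `ZilberGammaStateTypes` -/

namespace Literature.NumberTheory.Transcendental

/-! ### Γ-field lemmas: strongness over sub-bases, attainment of `td`, reduction to closed tuples -/

namespace GammaField

open Literature.ModelTheory.ExponentialFields.ExponentialRing ZilberSaturationMain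

variable {F : Type u} [Field F] [CharZero F] [Literature.ModelTheory.ExponentialFields.ExponentialRing F]

/-- **Strongness descends to a strong sub-base with the same transcendence degree** (the
"`δ`-stabilisation" step): if `K_b ≤ K₂` with `K_b` strong, `d` is linearly independent over `K₂` with
`K₂ + ℚd ◁ F`, and `td(d/K_b) = td(d/K₂)`, then `K_b + ℚd ◁ F`. For `Y ⊇ K_b + ℚd` finitely
generated: `δ(Y/K_b + ℚd) = δ(Y/K_b) - δ(d/K_b)`, `δ(Y/K_b) = δ(Y ∩ K₂/K_b) + δ(Y/Y ∩ K₂) ≥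
0 + δ(Y + K₂/K₂) = δ(d/K₂) + δ(Y + K₂/K₂ + ℚd) ≥ δ(d/K₂) = δ(d/K_b)`.
[cite: BaysKirby2018ANT, Lemma 4.2 (2), (3) and Def. 4.3] -/
theorem isStrong_sup_span_of_td_eq {Kb K₂ : Submodule ℚ F} (hle : Kb ≤ K₂) (hKb : IsStrong Kb)
    {N : ℕ} {d : Fin N → F} (hd : LinIndepOver K₂ d)
    (hs : IsStrong (K₂ ⊔ Submodule.span ℚ (range d)))
    (htd : td Kb (Submodule.span ℚ (range d)) = td K₂ (Submodule.span ℚ (range d))) :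
    IsStrong (Kb ⊔ Submodule.span ℚ (range d)) := by
  set Sd : Submodule ℚ F := Submodule.span ℚ (range d) with hSd
  have hfgd : ∀ X : Submodule ℚ F, IsFG X Sd := fun X => isFG_span_of_finite X (finite_range d)
  have hδeq : predim Kb Sd = predim K₂ Sd := by
    rw [predim_def, predim_def, htd, ldim_span_eq_of_linIndepOver hd, ldim_span_eq_of_linIndepOver (hd.of_le hle)]
  intro Y hY hfgY
  have hfgKbY : IsFG Kb Y := (isFG_sup_left.2 (hfgd Kb)).trans hfgY
  -- `δ(Y/K_b + ℚd) = δ(Y/K_b) - δ(d/K_b)`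
  have h1 := predim_add (le_sup_left : Kb ≤ Kb ⊔ Sd) hY hfgKbY
  rw [predim_sup_left] at h1
  -- `δ(Y/K_b) = δ(Y ∩ K₂/K_b) + δ(Y/Y ∩ K₂)`
  have hKbYK : Kb ≤ Y ⊓ K₂ := le_inf (le_sup_left.trans hY) hle
  have h2 := predim_add hKbYK (inf_le_left : Y ⊓ K₂ ≤ Y) hfgKbY
  have h3 : 0 ≤ predim Kb (Y ⊓ K₂) := hKb hKbYK (hfgKbY.mono inf_le_left)
  -- `δ(Y/Y ∩ K₂) ≥ δ(Y + K₂/K₂)`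
  have hfgYK : IsFG (Y ⊓ K₂) Y := hfgKbY.of_le_left hKbYK
  have h4 : predim K₂ (Y ⊔ K₂) ≤ predim (Y ⊓ K₂) Y := predim_sup_le Y K₂ hfgYK
  -- `δ(Y + K₂/K₂) = δ(d/K₂) + δ(Y + K₂/K₂ + ℚd)`
  have hSdY : Sd ≤ Y := le_sup_right.trans hY
  have hfgK₂YK : IsFG K₂ (Y ⊔ K₂) := isFG_sup_right.2 ((isFG_iff_isFG_inf Y K₂).2 hfgYK)
  have h5 := predim_add (le_sup_left : K₂ ≤ K₂ ⊔ Sd) (sup_le le_sup_right (hSdY.trans le_sup_left) :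
    K₂ ⊔ Sd ≤ Y ⊔ K₂) hfgK₂YK
  rw [predim_sup_left] at h5
  have h6 : 0 ≤ predim (K₂ ⊔ Sd) (Y ⊔ K₂) :=
    hs (sup_le le_sup_right (hSdY.trans le_sup_left)) (hfgK₂YK.of_le_left le_sup_left)
  linarith

/-- **`td(d/Λ)` as a relative rank of finitely many elements**: `td Λ (span d) = rk((d, exp d)/gens Λ)`
in the algebraic matroid. [folklore] -/
theorem td_span_range_eq_relRank (Λ : Submodule ℚ F) {N : ℕ} (d : Fin N → F) :
    td Λ (Submodule.span ℚ (range d)) = (algMatroid F).relRank (gens Λ) (range (gammaPt d)) := by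
  rw [range_gammaPt]
  refine le_antisymm (td_span_le_relRank Λ (range d)) ?_
  calc (algMatroid F).relRank (gens Λ) (range d ∪ exp '' range d)
      ≤ (algMatroid F).relRank (gens Λ) (gens (Λ ⊔ Submodule.span ℚ (range d))) := by
        refine (algMatroid F).relRank_mono_right _ ?_
        rintro b (⟨j, rfl⟩ | ⟨_, ⟨j, rfl⟩, rfl⟩)
        · exact mem_gens_of_mem (Submodule.mem_sup_right (Submodule.subset_span ⟨j, rfl⟩))
        · exact exp_mem_gens (Submodule.mem_sup_right (Submodule.subset_span ⟨j, rfl⟩))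
    _ = td Λ (Submodule.span ℚ (range d)) := by rw [← td_def, td_sup_left]

/-- **Strongness may be tested on finite tuples inside a strong `H ⊇ Λ`**: if `Λ ≤ H ◁ F` and
`δ(s/Λ) ≥ 0` for every finite `s ⊆ H`, then `Λ ◁ F` (for a finite `s`,
`δ(Λ + ℚs/Λ) = δ(X ∩ H/Λ) + δ(X/X ∩ H)` with `X = Λ + ℚs`; the second term is `≥ δ(X + H/H) ≥ 0`,
the first is the predimension of a finite tuple inside `H`). [cite: BaysKirby2018ANT, Lemma 4.2 (3), Def. 4.3] -/
theorem isStrong_of_forall_finset_subset {Λ H : Submodule ℚ F} (hH : IsStrong H) (hΛH : Λ ≤ H)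
    (h : ∀ s : Finset F, ↑s ⊆ (H : Set F) → 0 ≤ predim Λ (Submodule.span ℚ (s : Set F))) :
    IsStrong Λ := by
  classical
  rw [isStrong_iff_finset]
  intro s
  set X : Submodule ℚ F := Λ ⊔ Submodule.span ℚ (s : Set F) with hX
  have hfgX : IsFG Λ X := isFG_sup_left.2 (isFG_span_finset Λ s)
  have hΛXH : Λ ≤ X ⊓ H := le_inf le_sup_left hΛH
  have hadd := predim_add hΛXH (inf_le_left : X ⊓ H ≤ X) hfgX
  -- the second term
  have hfgXH : IsFG (X ⊓ H) X := hfgX.of_le_left hΛXH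
  have hsub : predim H (X ⊔ H) ≤ predim (X ⊓ H) X := predim_sup_le X H hfgXH
  have hHX : 0 ≤ predim H (X ⊔ H) := hH le_sup_right (isFG_sup_right.2 ((isFG_iff_isFG_inf X H).2 hfgXH))
  -- the first term: a finite tuple inside `H`
  have hfg1 : IsFG Λ (X ⊓ H) := hfgX.mono inf_le_left
  obtain ⟨t, htXH, hle⟩ := isFG_iff_exists_finset.1 hfg1
  have heq : X ⊓ H = Λ ⊔ Submodule.span ℚ (t : Set F) :=
    le_antisymm hle (sup_le hΛXH (Submodule.span_le.2 htXH))
  have h1 : 0 ≤ predim Λ (X ⊓ H) := by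
    rw [heq, predim_sup_left]
    exact h t (htXH.trans (fun z hz => (inf_le_right : X ⊓ H ≤ H) hz))
  rw [← predim_sup_left, ← hX]
  linarith

end GammaField

namespace ZilberHomogeneity

open GammaField Literature.ModelTheory.ExponentialFields.ExponentialRing
  Literature.ModelTheory.Quasiminimal ZilberPrimeModel ZilberSaturationMain

variable {K : Type u} [Field K] [CharZero K] [Literature.ModelTheory.ExponentialFields.ExponentialRing K]
variable {K' : Type u} [Field K'] [CharZero K'] [Literature.ModelTheory.ExponentialFields.ExponentialRing K']

/-! ### Attainment of `td` over closed sub-bases -/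

/-- **The transcendence degree of `d` over a closed base is attained over the closure of a finite
subset**: there is a finite `C₀ ⊆ ecl S` such that `td(d/span ecl T) = td(d/span ecl S)` for every
`T` with `C₀ ⊆ T ⊆ ecl S` (finitarity of the algebraic matroid,
`Matroid.exists_finite_subset_relRank_eq`, and antitonicity of relative rank in the base).
[cite: BaysKirby2013Excellence, Prop. 5 (proof: "`V` is over `G₀`")] -/
theorem exists_finset_forall_td_eq (S : Set K) {N : ℕ} (d : Fin N → K) :
    ∃ C₀ : Finset K, ↑C₀ ⊆ ecl S ∧ ∀ T : Set K, ↑C₀ ⊆ T → T ⊆ ecl S →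
      td (Submodule.span ℚ (ecl T)) (Submodule.span ℚ (range d)) =
        td (Submodule.span ℚ (ecl S)) (Submodule.span ℚ (range d)) := by
  classical
  have hgensS : gens (Submodule.span ℚ (ecl S)) = ecl S := by
    ext z
    rw [mem_gens_iff]
    constructor
    · rintro (hz | ⟨x, hx, rfl⟩)
      · rwa [← SetLike.mem_coe, coe_span_ecl] at hz
      · rw [← SetLike.mem_coe, coe_span_ecl] at hx
        exact Khovanskii.exp_mem_ecl hx
    · intro hz
      exact Or.inl (by rw [← SetLike.mem_coe, coe_span_ecl]; exact hz)
  obtain ⟨C₀, hC₀S, hC₀fin, hC₀⟩ := (algMatroid K).exists_finite_subset_relRank_eq_of_ground_eq_univ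
    rfl (C := ecl S) (X := range (gammaPt d)) (finite_range _)
  refine ⟨hC₀fin.toFinset, by rwa [Finite.coe_toFinset], fun T hC₀T hTS => ?_⟩
  rw [Finite.coe_toFinset] at hC₀T
  have hgensT : gens (Submodule.span ℚ (ecl T)) = ecl T := by
    ext z
    rw [mem_gens_iff]
    constructor
    · rintro (hz | ⟨x, hx, rfl⟩)
      · rwa [← SetLike.mem_coe, coe_span_ecl] at hz
      · rw [← SetLike.mem_coe, coe_span_ecl] at hx
        exact Khovanskii.exp_mem_ecl hx
    · intro hz
      exact Or.inl (by rw [← SetLike.mem_coe, coe_span_ecl]; exact hz)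
  rw [td_span_range_eq_relRank, td_span_range_eq_relRank, hgensS, hgensT]
  have hTsub : ecl T ⊆ ecl S := ecl_subset_ecl_of_subset hTS
  have hC₀T' : C₀ ⊆ ecl T := hC₀T.trans (subset_ecl T)
  refine le_antisymm ?_ ((algMatroid K).relRank_anti_left _ hTsub)
  rw [← hC₀]
  exact (algMatroid K).relRank_anti_left _ hC₀T'

/-! ### Strongness is transported along isomorphisms of closed sets -/

/-- **Predimensions of finite tuples inside a closed set are preserved by isomorphisms of closed
sets**: for an E-isomorphism `Θ : ecl S ≅ ecl S'`, `ℚ`-subspaces `A ⊆ ecl S` of `K` and `A'` of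
`K'` with `Θ A = A'`, and a finite tuple `a ⊆ ecl S`: `δ(Θ a/A') = δ(a/A)` (transcendence degrees
by `IsEIsoOn₂.relRank_alg_image_eq`, linear dimensions by `ℚ`-linearity and injectivity of `Θ`
on `ecl S`). [cite: BaysKirby2013Excellence, Lemma 3 (proof)] -/
theorem predim_span_image_eq_of_isEIsoOn₂ {Θ : K → K'} {S : Set K} {S' : Set K'}
    (hΘ : IsEIsoOn₂ Θ (ecl S) (ecl S')) {A : Submodule ℚ K} {A' : Submodule ℚ K'}
    (hA : (A : Set K) ⊆ ecl S) (hAA' : Θ '' (A : Set K) = (A' : Set K')) {m : ℕ} {a : Fin m → K}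
    (ha : ∀ i, a i ∈ ecl S) :
    predim A' (Submodule.span ℚ (range (Θ ∘ a))) = predim A (Submodule.span ℚ (range a)) := by
  classical
  -- transcendence degrees
  have hgensA : gens A ⊆ ecl S := by
    rintro z (hz | ⟨x, hx, rfl⟩)
    · exact hA hz
    · exact Khovanskii.exp_mem_ecl (hA hx)
  have hgens : Θ '' gens A = gens A' := by
    ext w
    constructor
    · rintro ⟨z, hz | ⟨x, hx, rfl⟩, rfl⟩
      · exact mem_gens_of_mem (show Θ z ∈ (A' : Set K') from hAA' ▸ mem_image_of_mem Θ hz)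
      · rw [hΘ.map_exp (hA hx)]
        exact exp_mem_gens (show Θ x ∈ (A' : Set K') from hAA' ▸ mem_image_of_mem Θ hx)
    · rintro (hw | ⟨y, hy, rfl⟩)
      · have : w ∈ Θ '' (A : Set K) := by rw [hAA']; exact hw
        obtain ⟨z, hz, rfl⟩ := this
        exact ⟨z, mem_gens_of_mem hz, rfl⟩
      · have : y ∈ Θ '' (A : Set K) := by rw [hAA']; exact hy
        obtain ⟨x, hx, rfl⟩ := this
        exact ⟨exp x, exp_mem_gens hx, hΘ.map_exp (hA hx)⟩
  have hγ : Θ '' range (gammaPt a) = range (gammaPt (Θ ∘ a)) := by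
    rw [← range_comp]
    refine congrArg range (funext fun r => ?_)
    rcases r with i | i
    · rw [Function.comp_apply, gammaPt_inl, gammaPt_inl]; rfl
    · rw [Function.comp_apply, gammaPt_inr, gammaPt_inr]; exact hΘ.map_exp (ha i)
  have hγsub : range (gammaPt a) ⊆ ecl S := by
    rw [range_gammaPt]
    rintro z (⟨i, rfl⟩ | ⟨_, ⟨i, rfl⟩, rfl⟩)
    · exact ha i
    · exact Khovanskii.exp_mem_ecl (ha i)
  have htd : td A' (Submodule.span ℚ (range (Θ ∘ a))) = td A (Submodule.span ℚ (range a)) := by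
    rw [td_span_range_eq_relRank, td_span_range_eq_relRank, ← hgens, ← hγ]
    exact (hΘ.relRank_alg_image_eq hgensA hγsub).symm
  -- linear dimensions: a maximal `A`-independent sub-tuple
  obtain ⟨r, ρ, hind, hspan⟩ := exists_linIndepOver_comp A a
  have hind' : LinIndepOver A' ((Θ ∘ a) ∘ ρ) := by
    intro q hq
    have hq' : (∑ i, q i • Θ (a (ρ i))) ∈ (A' : Set K') := hq
    rw [← hAA'] at hq'
    obtain ⟨κ, hκ, hκeq⟩ := hq'
    have hsum : Θ (∑ i, q i • a (ρ i)) = ∑ i, q i • Θ (a (ρ i)) := hΘ.map_sum_smul q fun i => ha (ρ i)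
    have hmem : (∑ i, q i • a (ρ i)) ∈ ecl S := sum_smul_mem_ecl q (fun i => ha (ρ i)) _
    have heq : κ = ∑ i, q i • a (ρ i) := hΘ.bijOn.injOn (hA hκ) hmem (by rw [hκeq, hsum])
    have hκA : (∑ i, q i • a (ρ i)) ∈ A := by rw [← heq]; exact hκ
    exact hind q hκA
  have hspan' : A' ⊔ Submodule.span ℚ (range ((Θ ∘ a) ∘ ρ)) = A' ⊔ Submodule.span ℚ (range (Θ ∘ a)) := by
    refine le_antisymm (sup_le le_sup_left ((Submodule.span_mono ?_).trans le_sup_right))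
      (sup_le le_sup_left (Submodule.span_le.2 ?_))
    · rintro _ ⟨i, rfl⟩; exact ⟨ρ i, rfl⟩
    · rintro _ ⟨i, rfl⟩
      have hai : a i ∈ A ⊔ Submodule.span ℚ (range (a ∘ ρ)) := by
        rw [hspan]; exact Submodule.mem_sup_right (Submodule.subset_span ⟨i, rfl⟩)
      obtain ⟨κ, hκ, w, hw, hsum⟩ := Submodule.mem_sup.1 hai
      obtain ⟨q, rfl⟩ := (Submodule.mem_span_range_iff_exists_fun ℚ).1 hw
      have e1 : Θ (a i) = Θ κ + ∑ j, q j • Θ (a (ρ j)) := by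
        rw [← hsum]; exact hΘ.map_add_sum_smul (hA hκ) q fun j => ha (ρ j)
      rw [SetLike.mem_coe, Function.comp_apply, e1]
      refine add_mem (Submodule.mem_sup_left ?_) (Submodule.mem_sup_right
        (Submodule.sum_mem _ fun j _ => Submodule.smul_mem _ _ (Submodule.subset_span ⟨j, rfl⟩)))
      show Θ κ ∈ (A' : Set K')
      rw [← hAA']; exact mem_image_of_mem Θ hκ
  have hldim : ldim A (Submodule.span ℚ (range a)) = r := by
    rw [← ldim_sup_left, ← hspan, ldim_sup_left, ldim_span_eq_of_linIndepOver hind]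
  have hldim' : ldim A' (Submodule.span ℚ (range (Θ ∘ a))) = r := by
    rw [← ldim_sup_left, ← hspan', ldim_sup_left, ldim_span_eq_of_linIndepOver hind']
  rw [predim_def, predim_def, htd, hldim, hldim']

/-- **Strongness is transported along isomorphisms of closed sets**: for an E-isomorphism
`Θ : ecl S ≅ ecl S'` and a strong `ℚ`-subspace `A ⊆ ecl S` of `K`, the subspace `A'` of `K'` with
`Θ A = A'` is strong in `K'` (test on finite tuples inside the strong `span ecl S'`,
`GammaField.isStrong_of_forall_finset_subset`, pulled back along `Θ`,
`predim_span_image_eq_of_isEIsoOn₂`). [cite: BaysKirby2013Excellence, Lemma 3] -/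
theorem isStrong_image_of_isEIsoOn₂ {Θ : K → K'} {S : Set K} {S' : Set K'}
    (hΘ : IsEIsoOn₂ Θ (ecl S) (ecl S')) {A : Submodule ℚ K} {A' : Submodule ℚ K'}
    (hA : (A : Set K) ⊆ ecl S) (hAA' : Θ '' (A : Set K) = (A' : Set K')) (hs : IsStrong A) :
    IsStrong A' := by
  classical
  have hH : IsStrong (Submodule.span ℚ (ecl S')) := (isGammaClosed_span_ecl_univ S').isStrong
  have hA'H : A' ≤ Submodule.span ℚ (ecl S') := by
    intro w hw
    have : w ∈ Θ '' (A : Set K) := by rw [hAA']; exact hw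
    obtain ⟨z, hz, rfl⟩ := this
    exact Submodule.subset_span (hΘ.bijOn.mapsTo (hA hz))
  refine isStrong_of_forall_finset_subset hH hA'H fun s hs' => ?_
  rw [coe_span_ecl] at hs'
  -- pull the finite tuple back along `Θ`
  set a' : Fin s.card → K' := fun i => (s.equivFin.symm i : K') with ha'
  have ha'mem : ∀ i, a' i ∈ ecl S' := fun i => hs' (s.equivFin.symm i).2
  have hpre : ∀ i, ∃ z ∈ ecl S, Θ z = a' i := fun i => hΘ.bijOn.surjOn (ha'mem i)
  choose a ha haΘ using hpre
  have hΘa : Θ ∘ a = a' := funext haΘ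
  have hspan : Submodule.span ℚ (s : Set K') = Submodule.span ℚ (range a') := by
    congr 1
    ext w
    constructor
    · intro hw; exact ⟨s.equivFin ⟨w, hw⟩, by simp [ha']⟩
    · rintro ⟨i, rfl⟩; exact (s.equivFin.symm i).2
  rw [hspan, ← hΘa, predim_span_image_eq_of_isEIsoOn₂ hΘ hA hAA' ha]
  exact (isStrong_iff.1 hs) _ (isFG_span_of_finite _ (finite_range a))

/-! ### From a cross Γ-isomorphism over the closed bases to quantifier-free types over the closed set -/

/-- **Quantifier-free types over a closed base from an isomorphism of closures covering the
supports**: if `Θ : ecl(T ∪ d) ≅ ecl(S'')` is `g` on `ecl T` and maps `d ↦ d'`, then tuples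
`xᵢ = κᵢ + ∑ qᵢⱼ dⱼ` with `κᵢ ∈ ecl T` and `x'ᵢ = g κᵢ + ∑ qᵢⱼ d'ⱼ` have the same quantifier-free
`Language.eclIso`-type over `ecl T` along `g`. [cite: Kirby2010QMEC, Prop. 3.5] -/
theorem eqQFTypeOver₂_ecl_of_isEIsoOn₂ {K K' : Type} [Field K] [Literature.ModelTheory.ExponentialFields.ExponentialRing K]
    [Field K'] [Literature.ModelTheory.ExponentialFields.ExponentialRing K'] {T : Set K} {S'' : Set K'}
    {g Θ : K → K'} {N : ℕ} {d : Fin N → K} {d' : Fin N → K'}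
    (hΘ : IsEIsoOn₂ Θ (ecl (T ∪ range d)) (ecl S'')) (hΘg : EqOn Θ g (ecl T)) (hΘd : ∀ j, Θ (d j) = d' j)
    {n : ℕ} {x : Fin n → K} {x' : Fin n → K'} {κ : Fin n → K} {q : Fin n → Fin N → ℚ}
    (hκ : ∀ i, κ i ∈ ecl T) (hxq : ∀ i, x i = κ i + ∑ j, q i j • d j)
    (hx'q : ∀ i, x' i = g (κ i) + ∑ j, q i j • d' j) :
    Language.eclIso.EqQFTypeOver₂ (ecl T) g x x' := by
  have hsub1 : ecl T ⊆ ecl (T ∪ range d) := ecl_mono subset_union_left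
  have hdmem : ∀ j, d j ∈ ecl (T ∪ range d) := fun j => subset_ecl _ (Or.inr ⟨j, rfl⟩)
  have hxmem : ∀ i, x i ∈ ecl (T ∪ range d) := by
    intro i
    rw [hxq i]
    exact Khovanskii.add_mem_ecl (hsub1 (hκ i)) (sum_smul_mem_ecl (q i) hdmem _)
  have hΘx : ∀ i, Θ (x i) = x' i := by
    intro i
    rw [hxq i, hx'q i, hΘ.map_add_sum_smul (hsub1 (hκ i)) (q i) hdmem, hΘg (hκ i)]
    congr 1
    exact Finset.sum_congr rfl fun j _ => by rw [hΘd j]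
  have hres : IsEIsoOn₂ Θ (ecl (ecl T ∪ range x)) (ecl (Θ '' (ecl T ∪ range x))) := by
    refine hΘ.restrict (union_subset hsub1 ?_)
    rintro _ ⟨i, rfl⟩; exact hxmem i
  exact eqQFTypeOver₂_of_isEIsoOn₂ hres hΘg hΘx

/-- **Descent and extension**: in the situation of `eqQFTypeOver₂_of_isGammaIsoTw₂`, for a finite
`b ⊆ S` with `span ecl b + ℚd ◁ K` and `span ecl (g b) + ℚd' ◁ K'`, the cross Γ-isomorphism
`d ↦ d'` over the base `ecl S` descends to the base `ecl b` (`IsGammaIsoTw₂.of_base_le`) and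
`g|ecl b ∪ (d ↦ d')` extends to an isomorphism `ecl(b, d) ≅ ecl(g b, d')`
(`exists_isEIsoOn₂_of_isGammaIsoTw₂`). [cite: BaysKirby2013Excellence, Lemma 3] [cite: Kirby2010QMEC, Thm 2.1] -/
theorem exists_isEIsoOn₂_restrict_of_isGammaIsoTw₂ (hK : IsZilberField K) (hK' : IsZilberField K')
    {S : Set K} {g : K → K'} (hg : IsEIsoOn₂ g (ecl S) (ecl (g '' S)))
    {N : ℕ} {d : Fin N → K} {d' : Fin N → K'} (hiso : IsGammaIsoTw₂ (baseEquiv₂ hg) d d')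
    {b : Finset K} (hbS : (b : Set K) ⊆ ecl S)
    (hsb : IsStrong (Submodule.span ℚ (ecl (b : Set K)) ⊔ Submodule.span ℚ (range d)))
    (hsb' : IsStrong (Submodule.span ℚ (ecl (g '' (b : Set K))) ⊔ Submodule.span ℚ (range d'))) :
    ∃ Θ : K → K', IsEIsoOn₂ Θ (ecl ((b : Set K) ∪ range d)) (ecl (g '' (b : Set K) ∪ range d')) ∧
      EqOn Θ g (ecl (b : Set K)) ∧ ∀ j, Θ (d j) = d' j := by
  have hgb : IsEIsoOn₂ g (ecl (b : Set K)) (ecl (g '' (b : Set K))) := hg.restrict hbS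
  have hle : Submodule.span ℚ (ecl (b : Set K)) ≤ Submodule.span ℚ (ecl S) :=
    Submodule.span_mono (ecl_subset_ecl_of_subset hbS)
  have hKL : (fieldOf (Submodule.span ℚ (ecl (b : Set K))) : Set K) ⊆ fieldOf (Submodule.span ℚ (ecl S)) :=
    fun z hz => fieldOf_mono hle hz
  have hisob : IsGammaIsoTw₂ (baseEquiv₂ hgb) d d' :=
    hiso.of_base_subset hKL (fun z hz => by rw [coe_baseEquiv₂, coe_baseEquiv₂])
  exact exists_isEIsoOn₂_of_isGammaIsoTw₂ hK hK' (Finset.finite_toSet b).countable hgb hisob hsb hsb'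

/-- **Cross Γ-isomorphisms over closed bases give equal quantifier-free types over the closed set**
(Bays–Kirby 2013, Lemma 3, in `Language.eclIso`, across two Zilber fields). Let `K`, `K'` be
Zilber fields, `S ⊆ K` an `ecl`-closed set, `g : S ≅ g S` an isomorphism of exponential
fields onto an `ecl`-closed set, `σ` the induced isomorphism of base Γ-fields, and `d ↦ d'` a
cross Γ-isomorphism over `σ`. Suppose that for a family of finite `b ⊆ S`, cofinal in the sense
that every finite subset of `S` lies in some `ecl b`, both `span ecl b + ℚd ◁ K` and
`span ecl (g b) + ℚd' ◁ K'`. Then for tuples `xᵢ = κᵢ + ∑ qᵢⱼ dⱼ` (`κᵢ ∈ span S`) and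
`x'ᵢ = g κᵢ + ∑ qᵢⱼ d'ⱼ`: `qftp(S, x) = qftp(g S, x')` along `g`. Proof: for finite `b̄ ⊆ S` take a
member `b` of the family with `b̄, κ ⊆ ecl b`; descend and extend
(`exists_isEIsoOn₂_restrict_of_isGammaIsoTw₂`) and read off the type of `(b̄, x)`
(`eqQFTypeOver₂_ecl_of_isEIsoOn₂`). [cite: BaysKirby2013Excellence, Lemma 3]
[cite: Kirby2010QMEC, Thm 2.1 and Prop. 3.5] -/
theorem eqQFTypeOver₂_of_isGammaIsoTw₂ {K K' : Type} [Field K] [CharZero K]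
    [Literature.ModelTheory.ExponentialFields.ExponentialRing K] [Field K'] [CharZero K']
    [Literature.ModelTheory.ExponentialFields.ExponentialRing K'] (hK : IsZilberField K) (hK' : IsZilberField K')
    {S : Set K} (hS : ecl S = S) {g : K → K'} (hg : IsEIsoOn₂ g (ecl S) (ecl (g '' S)))
    {N : ℕ} {d : Fin N → K} {d' : Fin N → K'} (hiso : IsGammaIsoTw₂ (baseEquiv₂ hg) d d')
    (𝔅 : Set (Finset K)) (h𝔅cof : ∀ b₀ : Finset K, ↑b₀ ⊆ S → ∃ b ∈ 𝔅, ↑b₀ ⊆ ecl (b : Set K))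
    (h𝔅S : ∀ b ∈ 𝔅, ↑b ⊆ S)
    (h𝔅s : ∀ b ∈ 𝔅, IsStrong (Submodule.span ℚ (ecl (b : Set K)) ⊔ Submodule.span ℚ (range d)))
    (h𝔅s' : ∀ b ∈ 𝔅, IsStrong (Submodule.span ℚ (ecl (g '' (b : Set K))) ⊔ Submodule.span ℚ (range d')))
    {n : ℕ} {x : Fin n → K} {x' : Fin n → K'} {κ : Fin n → K} {q : Fin n → Fin N → ℚ}
    (hκ : ∀ i, κ i ∈ Submodule.span ℚ S) (hxq : ∀ i, x i = κ i + ∑ j, q i j • d j)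
    (hx'q : ∀ i, x' i = g (κ i) + ∑ j, q i j • d' j) :
    Language.eclIso.EqQFTypeOver₂ S g x x' := by
  classical
  intro m b hb
  -- supports of the `κᵢ` and the parameters `b`
  have hT : ∀ i, ∃ T : Finset K, ↑T ⊆ S ∧ κ i ∈ Submodule.span ℚ (T : Set K) := fun i =>
    Submodule.mem_span_finite_of_mem_span (hκ i)
  choose T hTS hκT using hT
  obtain ⟨bb, hbb𝔅, hb₀bb⟩ := h𝔅cof (Finset.univ.image b ∪ Finset.univ.biUnion T) (by
    intro z hz
    rcases Finset.mem_union.1 (Finset.mem_coe.1 hz) with hz | hz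
    · obtain ⟨i, -, rfl⟩ := Finset.mem_image.1 hz
      exact hb i
    · obtain ⟨i, -, hzi⟩ := Finset.mem_biUnion.1 hz
      exact hTS i hzi)
  have hbbS : (bb : Set K) ⊆ ecl S := fun z hz => by rw [hS]; exact h𝔅S bb hbb𝔅 hz
  obtain ⟨Θ, hΘ, hΘg, hΘd⟩ :=
    exists_isEIsoOn₂_restrict_of_isGammaIsoTw₂ hK hK' hg hiso hbbS (h𝔅s bb hbb𝔅) (h𝔅s' bb hbb𝔅)
  have hbmem : ∀ i, b i ∈ ecl (bb : Set K) := fun i =>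
    hb₀bb (Finset.mem_coe.2 (Finset.mem_union.2 (Or.inl (Finset.mem_image.2 ⟨i, Finset.mem_univ i, rfl⟩))))
  have hκmem : ∀ i, κ i ∈ ecl (bb : Set K) := by
    intro i
    have hTi : (T i : Set K) ⊆ ecl (bb : Set K) := fun z hz =>
      hb₀bb (Finset.mem_coe.2 (Finset.mem_union.2 (Or.inr (Finset.mem_biUnion.2 ⟨i, Finset.mem_univ i, hz⟩))))
    have := Submodule.span_mono (R := ℚ) hTi (hκT i)
    rwa [← SetLike.mem_coe, coe_span_ecl] at this
  exact eqQFTypeOver₂_ecl_of_isEIsoOn₂ hΘ hΘg hΘd hκmem hxq hx'q b hbmem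

end ZilberHomogeneity

end Literature.NumberTheory.Transcendental

/-! ## Part V — from `ZilberClassHomogeneityII` -/

namespace Literature.NumberTheory.Transcendental

open GammaField ZilberHomogeneity ZilberSaturationMain ZilberPrimeModel
  Literature.ModelTheory.ExponentialFields.ExponentialRing

/-! ### Isomorphisms of closed sets from embeddings of closed E-subfields -/

section OfEHom

variable {K : Type*} [Field K] [ExponentialRing K] {K' : Type*} [Field K'] [ExponentialRing K']

/-- An embedding of exponential rings `φ : ecl S → K'` with image `ecl S'`, extended anyhow to a
total map, is an isomorphism of closed sets `ecl S ≅ ecl S'`. [folklore] -/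
theorem isEIsoOn₂_of_eHom {S : Set K} {S' : Set K'}
    (φ : ExponentialRingHom (Khovanskii.eclSubfield S) K') (hφ : Set.range φ = ecl S')
    {f : K → K'} (hf : ∀ z : Khovanskii.eclSubfield S, f z = φ z) : IsEIsoOn₂ f (ecl S) (ecl S') := by
  have hφinj : Function.Injective φ := φ.toRingHom.injective
  refine ⟨⟨fun z hz => ?_, fun u hu v hv huv => ?_, fun w hw => ?_⟩, fun u v hu hv => ?_,
    fun u v hu hv => ?_, fun u hu => ?_⟩
  · rw [hf ⟨z, hz⟩, ← hφ]; exact ⟨_, rfl⟩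
  · rw [hf ⟨u, hu⟩, hf ⟨v, hv⟩] at huv
    exact congrArg Subtype.val (hφinj huv)
  · rw [← hφ] at hw
    obtain ⟨z, rfl⟩ := hw
    exact ⟨z, z.2, hf z⟩
  · have := hf (⟨u, hu⟩ + ⟨v, hv⟩)
    rw [map_add, ← hf ⟨u, hu⟩, ← hf ⟨v, hv⟩] at this
    exact this
  · have := hf (⟨u, hu⟩ * ⟨v, hv⟩)
    rw [map_mul, ← hf ⟨u, hu⟩, ← hf ⟨v, hv⟩] at this
    exact this
  · have := hf (ExponentialRing.exp ⟨u, hu⟩)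
    rw [φ.map_exp, ← hf ⟨u, hu⟩] at this
    exact this

end OfEHom

/-! ### Closure-membership is a quantifier-free property -/

section MemEcl

variable {K : Type} [Field K] [ExponentialRing K] {K' : Type*} [Field K'] [ExponentialRing K']

/-- **Membership in the closure of a sub-tuple is determined by the quantifier-free type**: if
`qftp(u) = qftp(u')` then `u i₀ ∈ ecl(u[T]) ↔ u' i₀ ∈ ecl(u'[T])` for every finite set `T` of
indices (reindex to `snoc` form and use `mem_ecl_range_iff_of_eqQFType₂_snoc`).
[cite: Kirby2010QMEC, Lemma 1.3 and Prop. 3.5] -/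
theorem mem_ecl_image_iff_of_eqQFType₂ {ι : Type*} {u : ι → K} {u' : ι → K'}
    (h : Language.eclIso.EqQFType₂ u u') (T : Finset ι) (i₀ : ι) :
    u i₀ ∈ ecl (u '' (T : Set ι)) ↔ u' i₀ ∈ ecl (u' '' (T : Set ι)) := by
  classical
  set τ : Fin T.card → ι := fun j => (T.equivFin.symm j : ι) with hτ
  have hrange : u '' (T : Set ι) = Set.range (u ∘ τ) := by
    ext w
    constructor
    · rintro ⟨i, hi, rfl⟩
      exact ⟨T.equivFin ⟨i, hi⟩, by simp [hτ]⟩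
    · rintro ⟨j, rfl⟩
      exact ⟨τ j, (T.equivFin.symm j).2, rfl⟩
  have hrange' : u' '' (T : Set ι) = Set.range (u' ∘ τ) := by
    ext w
    constructor
    · rintro ⟨i, hi, rfl⟩
      exact ⟨T.equivFin ⟨i, hi⟩, by simp [hτ]⟩
    · rintro ⟨j, rfl⟩
      exact ⟨τ j, (T.equivFin.symm j).2, rfl⟩
  have key := h.comp (Fin.snoc τ i₀ : Fin (T.card + 1) → ι)
  rw [Fin.comp_snoc, Fin.comp_snoc] at key
  rw [hrange, hrange']
  exact mem_ecl_range_iff_of_eqQFType₂_snoc key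

end MemEcl

/-! ### Iterated extension of an isomorphism of closures along independent points of `G` -/

section Chain

variable {K : Type} [Field K] [CharZero K] [ExponentialRing K]
variable {K' : Type} [Field K'] [CharZero K'] [ExponentialRing K']

/-- **Iterated extension along independent points** (Kirby 2010 Thm 2.1 across two fields, applied
repeatedly): let `qftp(β, eX, x) = qftp(g β, g eX, x')`, `f₀ : ecl(β, x) ≅ ecl(g β, x')` an
isomorphism of closures with `f₀ β = g β`, `f₀ x = x'`, and suppose each `eX j` is independent from
`β, x` and the other `eX`. Then `f₀` extends to an isomorphism
`Θ : ecl(β, x, eX) ≅ ecl(g β, x', g eX)` with `Θ eX = g eX` (at each step the new point is generic on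
the left by independence and on the right by the equality of quantifier-free types,
`mem_ecl_image_iff_of_eqQFType₂`; extend by `IsZilberField.eclIso_extension₂`).
[cite: Kirby2010QMEC, Thm 2.1] [cite: BaysKirby2013Excellence, Prop. 5 (proof: "`d' ≡_{G₀X} d`")] -/
theorem exists_isEIsoOn₂_chain (hK : IsZilberField K) (hK' : IsZilberField K')
    {m r n : ℕ} {β : Fin m → K} {eX : Fin r → K} {x : Fin n → K} {x' : Fin n → K'} {g : K → K'}
    (hU : Language.eclIso.EqQFType₂ (Sum.elim (Sum.elim β eX) x) (Sum.elim (Sum.elim (g ∘ β) (g ∘ eX)) x'))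
    {f₀ : K → K'} (hf₀ : IsEIsoOn₂ f₀ (ecl (range β ∪ range x)) (ecl (range (g ∘ β) ∪ range x')))
    (hind : ∀ j : Fin r, eX j ∉ ecl ((range β ∪ range x) ∪ eX '' {l : Fin r | l ≠ j})) :
    ∃ Θ : K → K', IsEIsoOn₂ Θ (ecl ((range β ∪ range x) ∪ range eX))
        (ecl ((range (g ∘ β) ∪ range x') ∪ range (g ∘ eX))) ∧
      EqOn Θ f₀ (ecl (range β ∪ range x)) ∧ ∀ j, Θ (eX j) = g (eX j) := by
  classical
  set U : (Fin m ⊕ Fin r) ⊕ Fin n → K := Sum.elim (Sum.elim β eX) x with hUdef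
  set U' : (Fin m ⊕ Fin r) ⊕ Fin n → K' := Sum.elim (Sum.elim (g ∘ β) (g ∘ eX)) x' with hU'def
  -- the index sets of the chain: `β`, `x`, and the first `j` of the `eX`
  let T : ℕ → Finset ((Fin m ⊕ Fin r) ⊕ Fin n) := fun j =>
    (Finset.univ.image (Sum.inl ∘ Sum.inl)) ∪ (Finset.univ.image Sum.inr) ∪
      ((Finset.univ.filter fun l : Fin r => l.val < j).image (Sum.inl ∘ Sum.inr))
  have himg_aux : ∀ {X : Type} (β₁ : Fin m → X) (e₁ : Fin r → X) (x₁ : Fin n → X) (j : ℕ),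
      (Sum.elim (Sum.elim β₁ e₁) x₁) '' (T j : Set ((Fin m ⊕ Fin r) ⊕ Fin n)) =
        (range β₁ ∪ range x₁) ∪ e₁ '' {l : Fin r | l.val < j} := by
    intro X β₁ e₁ x₁ j
    ext w
    constructor
    · rintro ⟨idx, hidx, rfl⟩
      rw [Finset.mem_coe, Finset.mem_union, Finset.mem_union, Finset.mem_image, Finset.mem_image,
        Finset.mem_image] at hidx
      rcases hidx with (⟨i, -, rfl⟩ | ⟨i, -, rfl⟩) | ⟨l, hl, rfl⟩
      · exact Or.inl (Or.inl ⟨i, rfl⟩)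
      · exact Or.inl (Or.inr ⟨i, rfl⟩)
      · rw [Finset.mem_filter] at hl
        exact Or.inr ⟨l, hl.2, rfl⟩
    · rintro ((⟨i, rfl⟩ | ⟨i, rfl⟩) | ⟨l, hl, rfl⟩)
      · exact ⟨Sum.inl (Sum.inl i), Finset.mem_coe.2 (by simp [T]), rfl⟩
      · exact ⟨Sum.inr i, Finset.mem_coe.2 (by simp [T]), rfl⟩
      · exact ⟨Sum.inl (Sum.inr l), Finset.mem_coe.2 (by simpa [T] using hl), rfl⟩
  have himg : ∀ j : ℕ, U '' (T j : Set _) = (range β ∪ range x) ∪ eX '' {l : Fin r | l.val < j} :=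
    fun j => himg_aux β eX x j
  have himg' : ∀ j : ℕ, U' '' (T j : Set _) =
      (range (g ∘ β) ∪ range x') ∪ (g ∘ eX) '' {l : Fin r | l.val < j} :=
    fun j => himg_aux (g ∘ β) (g ∘ eX) x' j
  -- induction on the number of adjoined points
  have main : ∀ j : ℕ, j ≤ r → ∃ Θ : K → K',
      IsEIsoOn₂ Θ (ecl ((range β ∪ range x) ∪ eX '' {l : Fin r | l.val < j}))
        (ecl ((range (g ∘ β) ∪ range x') ∪ (g ∘ eX) '' {l : Fin r | l.val < j})) ∧
      EqOn Θ f₀ (ecl (range β ∪ range x)) ∧ ∀ l : Fin r, l.val < j → Θ (eX l) = g (eX l) := by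
    intro j
    induction j with
    | zero =>
      intro _
      refine ⟨f₀, ?_, fun _ _ => rfl, fun l hl => absurd hl (Nat.not_lt_zero _)⟩
      have h1 : eX '' {l : Fin r | l.val < 0} = ∅ := by
        rw [Set.image_eq_empty]; ext l; simp
      have h2 : (g ∘ eX) '' {l : Fin r | l.val < 0} = ∅ := by
        rw [Set.image_eq_empty]; ext l; simp
      rw [h1, h2, union_empty, union_empty]
      exact hf₀
    | succ j ih =>
      intro hj
      obtain ⟨Θ, hΘ, hΘf, hΘe⟩ := ih (Nat.le_of_succ_le hj)
      set l₀ : Fin r := ⟨j, hj⟩ with hl₀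
      -- the new point is generic on both sides
      have hsub : (range β ∪ range x) ∪ eX '' {l : Fin r | l.val < j} ⊆
          (range β ∪ range x) ∪ eX '' {l : Fin r | l ≠ l₀} := by
        refine union_subset_union_right _ (image_mono fun l hl => ?_)
        simp only [mem_setOf_eq] at hl ⊢
        intro h; rw [h, hl₀] at hl; exact lt_irrefl _ hl
      have ha : eX l₀ ∉ ecl ((range β ∪ range x) ∪ eX '' {l : Fin r | l.val < j}) :=
        fun h => hind l₀ (ecl_mono hsub h)
      have ha' : g (eX l₀) ∉ ecl ((range (g ∘ β) ∪ range x') ∪ (g ∘ eX) '' {l : Fin r | l.val < j}) := by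
        have key := mem_ecl_image_iff_of_eqQFType₂ hU (T j) (Sum.inl (Sum.inr l₀))
        rw [himg j, himg' j] at key
        exact fun h => ha (key.2 h)
      obtain ⟨Θ', hΘ', hΘ'Θ, hΘ'a⟩ := IsZilberField.eclIso_extension₂ hK hK'
        (((finite_range β).union (finite_range x)).union ((Set.toFinite _).image eX)).countable hΘ ha ha'
      have hset : insert (eX l₀) ((range β ∪ range x) ∪ eX '' {l : Fin r | l.val < j}) =
          (range β ∪ range x) ∪ eX '' {l : Fin r | l.val < j + 1} := by
        rw [← union_singleton, union_assoc]
        congr 1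
        ext w
        simp only [mem_union, mem_image, mem_setOf_eq, mem_singleton_iff]
        constructor
        · rintro (⟨l, hl, rfl⟩ | rfl)
          · exact ⟨l, Nat.lt_succ_of_lt hl, rfl⟩
          · exact ⟨l₀, Nat.lt_succ_self j, rfl⟩
        · rintro ⟨l, hl, rfl⟩
          rcases Nat.lt_succ_iff_lt_or_eq.1 hl with hl | hl
          · exact Or.inl ⟨l, hl, rfl⟩
          · right; congr 1; exact Fin.ext hl
      have hset' : insert (g (eX l₀)) ((range (g ∘ β) ∪ range x') ∪ (g ∘ eX) '' {l : Fin r | l.val < j}) =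
          (range (g ∘ β) ∪ range x') ∪ (g ∘ eX) '' {l : Fin r | l.val < j + 1} := by
        rw [← union_singleton, union_assoc]
        congr 1
        ext w
        simp only [mem_union, mem_image, mem_setOf_eq, mem_singleton_iff, Function.comp_apply]
        constructor
        · rintro (⟨l, hl, rfl⟩ | rfl)
          · exact ⟨l, Nat.lt_succ_of_lt hl, rfl⟩
          · exact ⟨l₀, Nat.lt_succ_self j, rfl⟩
        · rintro ⟨l, hl, rfl⟩
          rcases Nat.lt_succ_iff_lt_or_eq.1 hl with hl | hl
          · exact Or.inl ⟨l, hl, rfl⟩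
          · right; congr 2; exact Fin.ext hl
      rw [hset, hset'] at hΘ'
      refine ⟨Θ', hΘ', fun z hz => ?_, fun l hl => ?_⟩
      · rw [hΘ'Θ (ecl_mono subset_union_left hz)]; exact hΘf hz
      · rcases Nat.lt_succ_iff_lt_or_eq.1 hl with hl | hl
        · rw [hΘ'Θ (subset_ecl _ (Or.inr ⟨l, hl, rfl⟩))]; exact hΘe l hl
        · have : l = l₀ := Fin.ext hl
          rw [this]; exact hΘ'a
  obtain ⟨Θ, hΘ, hΘf, hΘe⟩ := main r le_rfl
  have h1 : eX '' {l : Fin r | l.val < r} = range eX := by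
    rw [← image_univ]; congr 1; ext l; simp
  have h2 : (g ∘ eX) '' {l : Fin r | l.val < r} = range (g ∘ eX) := by
    rw [← image_univ]; congr 1; ext l; simp
  rw [h1, h2] at hΘ
  exact ⟨Θ, hΘ, hΘf, fun j => hΘe j j.isLt⟩

end Chain

/-! ### Small closure lemmas -/

section EclLemmas

variable {K : Type*} [Field K] [ExponentialRing K]

/-- `ecl (A ∪ ecl B) = ecl (A ∪ B)`. [cite: Kirby2010, Lemma 3.3] -/
theorem ecl_union_ecl (A B : Set K) : ecl (A ∪ ecl B) = ecl (A ∪ B) := by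
  refine Subset.antisymm ?_ (ecl_mono (union_subset_union_right _ (subset_ecl B)))
  refine ecl_subset_ecl_of_subset (union_subset ((subset_union_left).trans (subset_ecl _)) ?_)
  exact ecl_mono subset_union_right

/-- `ecl (ecl B ∪ A) = ecl (B ∪ A)`. [cite: Kirby2010, Lemma 3.3] -/
theorem ecl_ecl_union (A B : Set K) : ecl (ecl B ∪ A) = ecl (B ∪ A) := by
  rw [union_comm, ecl_union_ecl, union_comm]

end EclLemmas

/-! ### The theorem -/

section Main

variable {K : Type} [Field K] [CharZero K] [ExponentialRing K]
variable {K' : Type} [Field K'] [CharZero K'] [ExponentialRing K']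

set_option maxHeartbeats 800000 in
/-- **Bays–Kirby 2013, Prop. 5 (ii) across two Zilber fields** (axiom (4ii) of a quasiminimal
pregeometry class over countable closed sets, for the class of Zilber fields, in `append` form).
Let `K`, `K'` be Zilber fields, `G ⊆ K` `ecl`-closed (countability is not needed), `g` an
isomorphism of exponential fields `G ≅ g G` onto an `ecl`-closed set, and `x`, `x'` tuples with
`qftp(G, x) = qftp(g G, x')` along `g`. Then every tuple `z ⊆ ecl(G ∪ x)` has a partner `z'` with
`qftp(G, x, z) = qftp(g G, x', z')` along `g`. See the module docstring for the proof.
[cite: BaysKirby2013Excellence, Prop. 5 (ii)] [cite: Haykazyan2016, Definition 2] -/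
theorem exists_eqQFTypeOver₂_append_of_closed (hK : IsZilberField K) (hK' : IsZilberField K')
    {G : Set K} (hG : ecl G = G) {g : K → K'} (hG' : ecl (g '' G) = g '' G)
    (hg : IsEIsoOn₂ g (ecl G) (ecl (g '' G)))
    {n : ℕ} {x : Fin n → K} {x' : Fin n → K'} (hxx' : Language.eclIso.EqQFTypeOver₂ G g x x')
    {k : ℕ} {z : Fin k → K} (hz : ∀ l, z l ∈ ecl (G ∪ range x)) :
    ∃ z' : Fin k → K', Language.eclIso.EqQFTypeOver₂ G g (Fin.append x z) (Fin.append x' z') := by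
  classical
  haveI := hK.isAlgClosed
  haveI := hK'.isAlgClosed
  -- the bases
  set K₂ : Submodule ℚ K := Submodule.span ℚ (ecl G) with hK₂def
  set K₂' : Submodule ℚ K' := Submodule.span ℚ (ecl (g '' G)) with hK₂'def
  have hK₂ : IsGammaClosed K₂ := isGammaClosed_span_ecl_univ _
  have hK₂' : IsGammaClosed K₂' := isGammaClosed_span_ecl_univ _
  have hmemK₂ : ∀ {w : K}, w ∈ K₂ ↔ w ∈ G := fun {w} => by
    rw [← SetLike.mem_coe, hK₂def, coe_span_ecl, hG]
  set σ := baseEquiv₂ hg with hσdef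
  set hiso₀ := isGammaIsoTw₂_elim0 (K := K) (K' := K') σ with hiso₀def
  -- Step 1: the normalised strong hull of `(x, z)`
  set w : Fin (n + k) → K := Fin.append x z with hwdef
  obtain ⟨N, d, hdind, hdstrong, hwmem, hEsub, hkum⟩ := exists_normalised_hull hK₂ w
  have hdecomp : ∀ i, ∃ κ ∈ K₂, ∃ q : Fin N → ℚ, w i = κ + ∑ j, q j • d j := by
    intro i
    obtain ⟨κ, hκ, v, hv, hsum⟩ := Submodule.mem_sup.1 (hwmem i)
    obtain ⟨q, rfl⟩ := (Submodule.mem_span_range_iff_exists_fun ℚ).1 hv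
    exact ⟨κ, hκ, q, hsum.symm⟩
  choose κ hκK₂ q hwq using hdecomp
  have hκG : ∀ i, κ i ∈ G := fun i => hmemK₂.1 (hκK₂ i)
  -- `d ⊆ ecl (G ∪ range x)`
  have hGxz : ecl (G ∪ range w) = ecl (G ∪ range x) := by
    refine Subset.antisymm (ecl_subset_ecl_of_subset (union_subset ?_ ?_)) (ecl_mono ?_)
    · exact fun u hu => subset_ecl _ (Or.inl hu)
    · rintro _ ⟨i, rfl⟩
      refine Fin.addCases (fun i' => ?_) (fun l => ?_) i
      · rw [hwdef, Fin.append_left]; exact subset_ecl _ (Or.inr ⟨i', rfl⟩)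
      · rw [hwdef, Fin.append_right]; exact hz l
    · refine union_subset_union_right _ ?_
      rintro _ ⟨i, rfl⟩; exact ⟨Fin.castAdd k i, by rw [hwdef, Fin.append_left]⟩
  have hdGx : ∀ j, d j ∈ ecl (G ∪ range x) := by
    intro j
    have h1 : d j ∈ K₂ ⊔ Submodule.span ℚ (range d) := Submodule.mem_sup_right (Submodule.subset_span ⟨j, rfl⟩)
    have h2 := hEsub h1
    rw [← SetLike.mem_coe, coe_span_ecl] at h2
    have h3 : ecl ((K₂ : Set K) ∪ range w) = ecl (G ∪ range x) := by
      rw [hK₂def, coe_span_ecl, hG]; exact hGxz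
    rwa [h3] at h2
  -- Step 2: the finite `b₀ ⊆ G`
  -- (a) coefficients of generators of the level-`0` locus ideal
  obtain ⟨gs, hgs⟩ := (inferInstance : IsNoetherianRing (MvPolynomial (Fin N ⊕ Fin N)
    (bfld K₂ (Fin.elim0 : Fin 0 → K)))).noetherian (locusIdeal K₂ (Fin.elim0 : Fin 0 → K) d)
  have hbot : bfld K₂ (Fin.elim0 : Fin 0 → K) = ⊥ := by
    rw [show (bfld K₂ (Fin.elim0 : Fin 0 → K)) = IntermediateField.adjoin (fieldOf K₂) (allGens (Fin.elim0 : Fin 0 → K)) from rfl,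
      SEACModel.allGens_elim0, IntermediateField.adjoin_empty]
  have hcoefK : ∀ c : bfld K₂ (Fin.elim0 : Fin 0 → K), ∃ kc : fieldOf K₂, (kc : K) = c := by
    intro c
    have hc : (c : K) ∈ (⊥ : IntermediateField (fieldOf K₂) K) := by rw [← hbot]; exact c.2
    obtain ⟨kc, hkc⟩ := IntermediateField.mem_bot.1 hc
    exact ⟨kc, hkc⟩
  choose kc hkc using hcoefK
  have hcoefG : ∀ c : bfld K₂ (Fin.elim0 : Fin 0 → K), (c : K) ∈ G := by
    intro c
    have : (c : K) ∈ acl (gens K₂) := coe_bfld_elim0_subset_acl K₂ c.2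
    exact hmemK₂.1 (hK₂.mem_of_mem_acl this)
  set C₁ : Finset K := gs.biUnion fun p => p.support.image fun mo =>
    ((p.coeff mo : bfld K₂ (Fin.elim0 : Fin 0 → K)) : K) with hC₁def
  have hC₁G : ↑C₁ ⊆ G := by
    intro c hc
    rw [hC₁def, Finset.coe_biUnion] at hc
    obtain ⟨p, -, hc⟩ := Set.mem_iUnion₂.1 hc
    rw [Finset.coe_image] at hc
    obtain ⟨mo, -, rfl⟩ := hc
    exact hcoefG _
  -- (b) attainment of the `ecl`-dimension of `d` over `G`
  set M := (isPregeometry_ecl K).matroid with hMdef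
  obtain ⟨C₂, hC₂G, hC₂fin, hC₂⟩ := M.exists_finite_subset_relRank_eq_of_ground_eq_univ rfl
    (C := G) (X := range d) (finite_range d)
  -- (c) attainment of `td(d/G)`
  obtain ⟨C₃, hC₃G, hC₃⟩ := exists_finset_forall_td_eq G d
  rw [hG] at hC₃G
  -- (d) `d ⊆ ecl (b₀ ∪ range x)` and the supports of the `κᵢ`
  have hfc : ∀ j, ∃ A : Finset K, ↑A ⊆ G ∧ d j ∈ ecl (↑A ∪ range x) := by
    intro j
    obtain ⟨A₀, hA₀, hA₀fin, hdA₀⟩ := (isPregeometry_ecl K).finite_character (hdGx j)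
    refine ⟨(hA₀fin.inter_of_left G).toFinset, ?_, ecl_mono ?_ hdA₀⟩
    · rw [Finite.coe_toFinset]; exact inter_subset_right
    · intro u hu
      rw [Finite.coe_toFinset]
      rcases hA₀ hu with huG | hux
      · exact Or.inl ⟨hu, huG⟩
      · exact Or.inr hux
  choose A hAG hdA using hfc
  have hT : ∀ i, ∃ T : Finset K, ↑T ⊆ G ∧ κ i ∈ Submodule.span ℚ (T : Set K) := fun i =>
    Submodule.mem_span_finite_of_mem_span (show κ i ∈ Submodule.span ℚ G from by
      rw [← hG]; exact hκK₂ i)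
  choose T hTG hκT using hT
  set b₀ : Finset K := C₁ ∪ hC₂fin.toFinset ∪ C₃ ∪ Finset.univ.biUnion A ∪ Finset.univ.biUnion T with hb₀def
  have hmemb₀ : ∀ u : K, u ∈ (b₀ : Set K) ↔ (((u ∈ C₁ ∨ u ∈ C₂) ∨ u ∈ C₃) ∨ ∃ j, u ∈ A j) ∨ ∃ i, u ∈ T i := by
    intro u
    rw [Finset.mem_coe, hb₀def]
    simp only [Finset.mem_union, Finset.mem_biUnion, Finset.mem_univ, true_and, Set.Finite.mem_toFinset]
  have hb₀G : ↑b₀ ⊆ G := by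
    intro u hu
    rcases (hmemb₀ u).1 hu with (((hu | hu) | hu) | ⟨i, hu⟩) | ⟨i, hu⟩
    · exact hC₁G hu
    · exact hC₂G hu
    · exact hC₃G hu
    · exact hAG i hu
    · exact hTG i hu
  have hC₁b₀ : ↑C₁ ⊆ (b₀ : Set K) := fun u hu => (hmemb₀ u).2 (Or.inl (Or.inl (Or.inl (Or.inl hu))))
  have hC₂b₀ : C₂ ⊆ (b₀ : Set K) := fun u hu => (hmemb₀ u).2 (Or.inl (Or.inl (Or.inl (Or.inr hu))))
  have hC₃b₀ : ↑C₃ ⊆ (b₀ : Set K) := fun u hu => (hmemb₀ u).2 (Or.inl (Or.inl (Or.inr hu)))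
  have hAb₀ : ∀ j, ↑(A j) ⊆ (b₀ : Set K) := fun j u hu => (hmemb₀ u).2 (Or.inl (Or.inr ⟨j, hu⟩))
  have hTb₀ : ∀ i, ↑(T i) ⊆ (b₀ : Set K) := fun i u hu => (hmemb₀ u).2 (Or.inr ⟨i, hu⟩)
  -- enumerate `b₀`
  set m₀ := b₀.card with hm₀
  set β : Fin m₀ → K := fun i => (b₀.equivFin.symm i : K) with hβdef
  have hβrange : range β = (b₀ : Set K) := by
    ext u; constructor
    · rintro ⟨i, rfl⟩; exact (b₀.equivFin.symm i).2
    · intro hu; exact ⟨b₀.equivFin ⟨u, hu⟩, by simp [hβdef]⟩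
  have hβG : ∀ i, β i ∈ G := fun i => hb₀G (b₀.equivFin.symm i).2
  set L : Set K := range β ∪ range x with hLdef
  have hLeq : range (Fin.append β x) = L := ZilberHomogeneity.range_append β x
  have hdL : ∀ j, d j ∈ ecl L := fun j => by
    refine ecl_mono ?_ (hdA j)
    rw [hLdef, hβrange]
    exact union_subset_union_left _ (hAb₀ j)
  have hκL : ∀ i, κ i ∈ ecl L := fun i => by
    have h1 : κ i ∈ Submodule.span ℚ (ecl L) := by
      refine Submodule.span_mono ?_ (hκT i)
      rw [hLdef, hβrange]
      exact (hTb₀ i).trans ((subset_union_left).trans (subset_ecl _))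
    rwa [← SetLike.mem_coe, coe_span_ecl] at h1
  have hspanb₀G : (Submodule.span ℚ (b₀ : Set K) : Set K) ⊆ G := by
    have h1 : Submodule.span ℚ (b₀ : Set K) ≤ Submodule.span ℚ (ecl G) :=
      Submodule.span_mono (hb₀G.trans (subset_ecl G))
    intro u hu
    have h2 := h1 hu
    rwa [← SetLike.mem_coe, coe_span_ecl, hG] at h2
  have hspanb₀L : (Submodule.span ℚ (b₀ : Set K) : Set K) ⊆ ecl L := by
    rw [← coe_span_ecl]
    refine Submodule.span_mono ?_
    rw [hLdef, hβrange]; exact (subset_union_left).trans (subset_ecl _)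
  -- Step 3: the pointed isomorphism `θ₀ : ecl(b₀, x) ≅ ecl(g b₀, x')`
  obtain ⟨φ, hφrange, hφt⟩ := exists_eHom_of_eqQFType₂ (hxx' β hβG)
  set f₀ : K → K' := fun u => if hu : u ∈ ecl (range (Fin.append β x)) then φ ⟨u, hu⟩ else 0 with hf₀def
  have hf₀φ : ∀ u : Khovanskii.eclSubfield (range (Fin.append β x)), f₀ u = φ u := fun u => by
    show (if hu : (u : K) ∈ ecl (range (Fin.append β x)) then φ ⟨u, hu⟩ else 0) = φ u
    rw [dif_pos (show (u : K) ∈ ecl (range (Fin.append β x)) from u.2)]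
  have hf₀iso' : IsEIsoOn₂ f₀ (ecl (range (Fin.append β x))) (ecl (range (Fin.append (g ∘ β) x'))) :=
    isEIsoOn₂_of_eHom φ hφrange hf₀φ
  have hL'eq : range (Fin.append (g ∘ β) x') = range (g ∘ β) ∪ range x' := ZilberHomogeneity.range_append _ _
  have hf₀iso : IsEIsoOn₂ f₀ (ecl L) (ecl (range (g ∘ β) ∪ range x')) := by
    rw [← hLeq, ← hL'eq]; exact hf₀iso'
  have hf₀φ' : ∀ (u : K) (hu : u ∈ ecl (range (Fin.append β x))), f₀ u = φ ⟨u, hu⟩ :=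
    fun u hu => hf₀φ ⟨u, hu⟩
  have hφt' : ∀ (u : K) (hu : u ∈ ecl (range (Fin.append β x))) (i : Fin (m₀ + n)),
      u = Fin.append β x i → φ ⟨u, hu⟩ = Fin.append (g ∘ β) x' i := by
    rintro u hu i rfl; exact hφt i
  have hf₀β : ∀ i, f₀ (β i) = g (β i) := by
    intro i
    have hmem : β i ∈ ecl (range (Fin.append β x)) := subset_ecl _ ⟨Fin.castAdd n i, Fin.append_left β x i⟩
    rw [hf₀φ' _ hmem, hφt' _ hmem (Fin.castAdd n i) (Fin.append_left β x i).symm, Fin.append_left]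
    rfl
  have hf₀x : ∀ i, f₀ (x i) = x' i := by
    intro i
    have hmem : x i ∈ ecl (range (Fin.append β x)) := subset_ecl _ ⟨Fin.natAdd m₀ i, Fin.append_right β x i⟩
    rw [hf₀φ' _ hmem, hφt' _ hmem (Fin.natAdd m₀ i) (Fin.append_right β x i).symm, Fin.append_right]
  -- `f₀ = g` on `span b₀`
  have hf₀g : ∀ u ∈ Submodule.span ℚ (b₀ : Set K), f₀ u = g u := by
    intro u hu
    refine Submodule.span_induction ?_ ?_ ?_ ?_ hu
    · intro u hu
      obtain ⟨i, rfl⟩ : u ∈ range β := by rw [hβrange]; exact hu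
      exact hf₀β i
    · rw [hf₀iso.map_zero, hg.map_zero]
    · intro u v hu' hv' hfu hfv
      rw [hf₀iso.map_add (hspanb₀L hu') (hspanb₀L hv'),
        hg.map_add (by rw [hG]; exact hspanb₀G hu') (by rw [hG]; exact hspanb₀G hv'), hfu, hfv]
    · intro a u hu' hfu
      rw [hf₀iso.map_smul_of_mem a (hspanb₀L hu'),
        hg.map_smul_of_mem a (by rw [hG]; exact hspanb₀G hu'), hfu]
  have hf₀κ : ∀ i, f₀ (κ i) = g (κ i) := fun i => hf₀g _ (Submodule.span_mono (hTb₀ i) (hκT i))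
  -- the partners
  set d' : Fin N → K' := fun j => f₀ (d j) with hd'def
  set w' : Fin (n + k) → K' := fun i => f₀ (w i) with hw'def
  have hw'q : ∀ i, w' i = g (κ i) + ∑ j, q i j • d' j := by
    intro i
    show f₀ (w i) = _
    rw [hwq i, hf₀iso.map_add_sum_smul (hκL i) (q i) hdL, hf₀κ i]
  have hwL : ∀ i, w i ∈ ecl L := fun i => by
    rw [hwq i]; exact Khovanskii.add_mem_ecl (hκL i) (sum_smul_mem_ecl (q i) hdL _)
  -- Step 3': `(d', exp d')` is a zero of the transported level-`0` ideal
  have hzero : gammaPt d' ∈ MvPolynomial.zeroLocus K' (locusIdealTw₂ hiso₀ d) := by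
    have hdL' : ∀ j, d j ∈ ecl (range (Fin.append β x)) := fun j => by rw [hLeq]; exact hdL j
    refine gammaPt_mem_zeroLocus_locusIdealTw₂_of_eHom σ φ hdL' (fun j => (hf₀φ ⟨d j, hdL' j⟩).symm) gs hgs ?_
    intro p hp mo hmo
    have hcmem : ((p.coeff mo : bfld K₂ (Fin.elim0 : Fin 0 → K)) : K) ∈ (C₁ : Set K) := by
      rw [hC₁def, Finset.coe_biUnion]
      exact Set.mem_iUnion₂.2 ⟨p, Finset.mem_coe.2 hp, by rw [Finset.coe_image]; exact ⟨mo, Finset.mem_coe.2 hmo, rfl⟩⟩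
    have hcL : ((p.coeff mo : bfld K₂ (Fin.elim0 : Fin 0 → K)) : K) ∈ ecl (range (Fin.append β x)) := by
      rw [hLeq]; exact hspanb₀L (Submodule.subset_span (hC₁b₀ hcmem))
    refine ⟨hcL, ?_⟩
    rw [← hf₀φ ⟨_, hcL⟩]
    show f₀ ((p.coeff mo : bfld K₂ (Fin.elim0 : Fin 0 → K)) : K) = _
    rw [hf₀g _ (Submodule.subset_span (hC₁b₀ hcmem))]
    -- the right-hand side is `σ` of the coefficient, i.e. `g` of it
    have hceq : (p.coeff mo : bfld K₂ (Fin.elim0 : Fin 0 → K)) =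
        ⟨(kc (p.coeff mo) : K), (bfld K₂ (Fin.elim0 : Fin 0 → K)).algebraMap_mem (kc (p.coeff mo))⟩ :=
      Subtype.ext (hkc _).symm
    rw [hceq, hiso₀.coe_fieldEquiv_algebraMap, hσdef, coe_baseEquiv₂, hkc]
  -- Step 4: the basis `X` of `G` over `ecl b₀` and the isomorphisms along finite `X₀ ⊆ X`
  set C : Set K := ecl (b₀ : Set K) with hCdef
  have hCG : C ⊆ G := by rw [hCdef, ← hG]; exact ecl_subset_ecl_of_subset (by rw [hG]; exact hb₀G)
  obtain ⟨XB, hXB⟩ := (M.contract C).exists_isBasis' G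
  have hXBG : XB ⊆ G := hXB.subset
  have hGXB : G ⊆ ecl (XB ∪ (b₀ : Set K)) := by
    intro u hu
    by_cases huC : u ∈ C
    · rw [← ecl_union_ecl]; exact subset_ecl _ (Or.inr huC)
    · have h1 : u ∈ G ∩ (M.contract C).E := ⟨hu, by
        rw [Matroid.contract_ground, hMdef, IsPregeometry.matroid_E]; exact ⟨mem_univ u, huC⟩⟩
      have h2 := hXB.isBasis_inter_ground.subset_closure h1
      rw [Matroid.contract_closure_eq, hMdef, IsPregeometry.matroid_closure] at h2
      rw [← ecl_union_ecl]; exact h2.1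
  -- the dimension count: `rk(d/ecl b₀) = rk(d/G)`
  have hrk : M.relRank G (range d) = M.relRank C (range d) := by
    refine le_antisymm (M.relRank_anti_left _ hCG) ?_
    rw [← hC₂]
    exact M.relRank_anti_left _ (hC₂b₀.trans (subset_ecl _))
  have hrklt : M.relRank C (range d) < ⊤ := M.relRank_lt_top_of_finite C ((finite_range d).subset sdiff_subset)
  have hκC : ∀ i, κ i ∈ C := fun i => by
    have h1 : κ i ∈ Submodule.span ℚ (ecl (b₀ : Set K)) :=
      Submodule.span_mono ((hTb₀ i).trans (subset_ecl _)) (hκT i)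
    rwa [← SetLike.mem_coe, coe_span_ecl] at h1
  -- `ecl (C ∪ range d ∪ T) = ecl (L ∪ T)`
  have hxCd : range x ⊆ ecl (C ∪ range d) := by
    rintro _ ⟨i, rfl⟩
    have h1 : x i = w (Fin.castAdd k i) := by rw [hwdef, Fin.append_left]
    rw [h1, hwq]
    exact Khovanskii.add_mem_ecl (subset_ecl (C ∪ range d) (Or.inl (hκC _)))
      (sum_smul_mem_ecl (q _) (fun j => subset_ecl (C ∪ range d) (Or.inr ⟨j, rfl⟩)) _)
  have hLsub : ∀ T : Set K, ecl (L ∪ T) ⊆ ecl ((C ∪ range d) ∪ T) := by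
    intro T'
    refine ecl_subset_ecl_of_subset (union_subset (union_subset ?_ ?_) ?_)
    · rw [hβrange]; exact fun u hu => subset_ecl _ (Or.inl (Or.inl (subset_ecl _ hu)))
    · exact (hxCd.trans (ecl_mono subset_union_left))
    · exact fun u hu => subset_ecl _ (Or.inr hu)
  -- the isomorphisms `Θ_{X₀}`
  have hTheta : ∀ X₀ : Finset K, ↑X₀ ⊆ XB → ∃ Θ : K → K',
      IsEIsoOn₂ Θ (ecl (L ∪ ↑X₀)) (ecl ((range (g ∘ β) ∪ range x') ∪ g '' ↑X₀)) ∧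
      EqOn Θ f₀ (ecl L) ∧ ∀ e ∈ X₀, Θ e = g e := by
    intro X₀ hX₀
    set r := X₀.card with hr
    set eX : Fin r → K := fun j => (X₀.equivFin.symm j : K) with heXdef
    have heXrange : range eX = (X₀ : Set K) := by
      ext u; constructor
      · rintro ⟨j, rfl⟩; exact (X₀.equivFin.symm j).2
      · intro hu; exact ⟨X₀.equivFin ⟨u, hu⟩, by simp [heXdef]⟩
    have heXinj : Function.Injective eX := fun a b hab => by
      have := Subtype.ext hab
      simpa [heXdef] using this
    have heXG : ∀ j, eX j ∈ G := fun j => hXBG (hX₀ (X₀.equivFin.symm j).2)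
    -- the quantifier-free type of `(β, eX, x)`
    have hP : ∀ i, Fin.append β eX i ∈ G := fun i => by
      refine Fin.addCases (fun i' => ?_) (fun j => ?_) i
      · rw [Fin.append_left]; exact hβG i'
      · rw [Fin.append_right]; exact heXG j
    have hU0 := hxx' (Fin.append β eX) hP
    set ρ : (Fin m₀ ⊕ Fin r) ⊕ Fin n → Fin (m₀ + r + n) :=
      Sum.elim (Sum.elim (fun i => Fin.castAdd n (Fin.castAdd r i)) (fun j => Fin.castAdd n (Fin.natAdd m₀ j)))
        (fun i => Fin.natAdd (m₀ + r) i) with hρ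
    have hU : Language.eclIso.EqQFType₂ (Sum.elim (Sum.elim β eX) x) (Sum.elim (Sum.elim (g ∘ β) (g ∘ eX)) x') := by
      refine (hU0.comp ρ).congr ?_ ?_
      · funext s; rcases s with (i | j) | i
        · simp [hρ]
        · simp [hρ]
        · simp [hρ]
      · funext s; rcases s with (i | j) | i
        · simp [hρ]
        · simp [hρ]
        · simp [hρ]
    -- independence of the `eX j` over `L` and the other `eX`
    have hX₀ind : (M.contract C).Indep (X₀ : Set K) := hXB.indep.subset hX₀
    have hind' := M.contract_indep_union_of_relRank_eq hX₀ind X₀.finite_toSet hCG (hX₀.trans hXBG) hrklt hrk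
    rw [hMdef, (isPregeometry_ecl K).contract_indep_iff] at hind'
    have hind : ∀ j : Fin r, eX j ∉ ecl ((range β ∪ range x) ∪ eX '' {l : Fin r | l ≠ j}) := by
      intro j hj
      refine hind'.2 (show eX j ∈ (X₀ : Set K) from (X₀.equivFin.symm j).2) ?_
      refine hLsub _ (ecl_mono (union_subset_union_right _ ?_) hj)
      rintro _ ⟨l, hl, rfl⟩
      exact ⟨(X₀.equivFin.symm l).2, fun h => hl (heXinj (mem_singleton_iff.1 h))⟩
    obtain ⟨Θ, hΘ, hΘf, hΘe⟩ := exists_isEIsoOn₂_chain hK hK' hU hf₀iso hind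
    have e2 : range (g ∘ eX) = g '' (X₀ : Set K) := by rw [range_comp, heXrange]
    rw [heXrange, e2] at hΘ
    refine ⟨Θ, hΘ, hΘf, fun e he => ?_⟩
    obtain ⟨j, rfl⟩ : e ∈ range eX := by rw [heXrange]; exact he
    exact hΘe j
  -- Step 4': `td(d'/g G) ≥ td(d/G)`
  set t : ℕ∞ := td K₂ (Submodule.span ℚ (range d)) with htdef
  have htK : t = (algMatroid K).relRank G (range (gammaPt d)) := by
    rw [htdef, td_span_range_eq_relRank, hK₂def, GammaField.gens_span_ecl, hG]
  have hγdL : range (gammaPt d) ⊆ ecl L := by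
    rw [range_gammaPt]
    rintro u (⟨j, rfl⟩ | ⟨_, ⟨j, rfl⟩, rfl⟩)
    · exact hdL j
    · exact Khovanskii.exp_mem_ecl (hdL j)
  have htd : t ≤ td K₂' (Submodule.span ℚ (range d')) := by
    obtain ⟨C', hC'G, hC'fin, hC'⟩ := (algMatroid K').exists_finite_subset_relRank_eq_of_ground_eq_univ rfl
      (C := g '' G) (X := range (gammaPt d')) (finite_range _)
    -- a finite `X₀ ⊆ XB` with `C' ⊆ ecl (g (b₀ ∪ X₀))`
    have hpre : ∀ c' : C', ∃ X₀ : Finset K, ↑X₀ ⊆ XB ∧ (c' : K') ∈ g '' ecl (↑X₀ ∪ (b₀ : Set K)) := by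
      intro c'
      obtain ⟨c, hcG, hcc'⟩ := hC'G c'.2
      obtain ⟨A₀, hA₀, hA₀fin, hcA₀⟩ := (isPregeometry_ecl K).finite_character (hGXB hcG)
      refine ⟨(hA₀fin.inter_of_left XB).toFinset, ?_, ⟨c, ecl_mono ?_ hcA₀, hcc'⟩⟩
      · rw [Finite.coe_toFinset]; exact inter_subset_right
      · intro u hu
        rw [Finite.coe_toFinset]
        rcases hA₀ hu with huX | hub
        · exact Or.inl ⟨hu, huX⟩
        · exact Or.inr hub
    choose X₀f hX₀f hcX₀f using hpre
    haveI : Fintype C' := hC'fin.fintype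
    set X₀ : Finset K := Finset.univ.biUnion X₀f with hX₀def
    have hX₀ : ↑X₀ ⊆ XB := by
      intro u hu
      rw [hX₀def, Finset.coe_biUnion] at hu
      obtain ⟨c', -, hu⟩ := Set.mem_iUnion₂.1 hu
      exact hX₀f c' hu
    obtain ⟨Θ, hΘ, hΘf, hΘe⟩ := hTheta X₀ hX₀
    have hb₀X₀G : (b₀ : Set K) ∪ ↑X₀ ⊆ G := union_subset hb₀G (hX₀.trans hXBG)
    -- images under `Θ`
    have hΘpt : ∀ u ∈ (b₀ : Set K) ∪ ↑X₀, Θ u = g u := by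
      rintro u (hu | hu)
      · obtain ⟨i, rfl⟩ : u ∈ range β := by rw [hβrange]; exact hu
        rw [hΘf (subset_ecl _ (Or.inl ⟨i, rfl⟩))]; exact hf₀β i
      · exact hΘe u hu
    have hsubS : (b₀ : Set K) ∪ ↑X₀ ⊆ L ∪ ↑X₀ := by rw [hLdef, hβrange]; exact union_subset_union_left _ subset_union_left
    have himg1 : Θ '' ecl ((b₀ : Set K) ∪ ↑X₀) = ecl (g '' ((b₀ : Set K) ∪ ↑X₀)) := by
      rw [hΘ.image_ecl (hsubS.trans (subset_ecl _))]
      congr 1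
      exact image_congr fun u hu => hΘpt u hu
    have himg2 : Θ '' range (gammaPt d) = range (gammaPt d') := by
      rw [← range_comp]
      refine congrArg range (funext fun s => ?_)
      rcases s with j | j
      · rw [Function.comp_apply, gammaPt_inl, gammaPt_inl]
        exact hΘf (hdL j)
      · rw [Function.comp_apply, gammaPt_inr, gammaPt_inr, hΘ.map_exp (ecl_mono subset_union_left (hdL j))]
        congr 1; exact hΘf (hdL j)
    have hC'sub : C' ⊆ ecl (g '' ((b₀ : Set K) ∪ ↑X₀)) := by
      intro c' hc'
      obtain ⟨c, hc, hcc'⟩ := hcX₀f ⟨c', hc'⟩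
      have hcc'' : g c = c' := hcc'
      rw [← hcc'', ← hg.image_ecl (by rw [hG]; exact hb₀X₀G)]
      refine mem_image_of_mem g (ecl_mono ?_ hc)
      refine union_subset ?_ subset_union_left
      intro u hu
      refine Or.inr ?_
      rw [hX₀def, Finset.coe_biUnion]
      exact Set.mem_iUnion₂.2 ⟨⟨c', hc'⟩, Finset.mem_coe.2 (Finset.mem_univ _), hu⟩
    calc t = (algMatroid K).relRank G (range (gammaPt d)) := htK
      _ ≤ (algMatroid K).relRank (ecl ((b₀ : Set K) ∪ ↑X₀)) (range (gammaPt d)) :=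
          (algMatroid K).relRank_anti_left _ (by rw [← hG]; exact ecl_subset_ecl_of_subset (by rw [hG]; exact hb₀X₀G))
      _ = (algMatroid K').relRank (Θ '' ecl ((b₀ : Set K) ∪ ↑X₀)) (Θ '' range (gammaPt d)) :=
          hΘ.relRank_alg_image_eq (ecl_subset_ecl_of_subset (hsubS.trans (subset_ecl _)))
            (hγdL.trans (ecl_mono subset_union_left))
      _ = (algMatroid K').relRank (ecl (g '' ((b₀ : Set K) ∪ ↑X₀))) (range (gammaPt d')) := by rw [himg1, himg2]
      _ ≤ (algMatroid K').relRank C' (range (gammaPt d')) := (algMatroid K').relRank_anti_left _ hC'sub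
      _ = (algMatroid K').relRank (g '' G) (range (gammaPt d')) := hC'
      _ = td K₂' (Submodule.span ℚ (range d')) := by
          rw [td_span_range_eq_relRank, hK₂'def, GammaField.gens_span_ecl, hG']
  -- Step 5: the cross Γ-isomorphism `d ↦ d'`
  obtain ⟨hΓ, htd'⟩ := isGammaIsoTw₂_of_mem_zeroLocus_of_td_le hK₂ σ hkum hzero htd
  -- the cofinal family of strong sub-bases
  set 𝔅 : Set (Finset K) := {bb | ∃ X₀ : Finset K, ↑X₀ ⊆ XB ∧ bb = b₀ ∪ X₀} with h𝔅def
  have h𝔅cof : ∀ T₀ : Finset K, ↑T₀ ⊆ G → ∃ bb ∈ 𝔅, ↑T₀ ⊆ ecl (bb : Set K) := by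
    intro T₀ hT₀
    have hpre : ∀ u : T₀, ∃ X₀ : Finset K, ↑X₀ ⊆ XB ∧ (u : K) ∈ ecl (↑X₀ ∪ (b₀ : Set K)) := by
      intro u
      obtain ⟨A₀, hA₀, hA₀fin, huA₀⟩ := (isPregeometry_ecl K).finite_character (hGXB (hT₀ u.2))
      refine ⟨(hA₀fin.inter_of_left XB).toFinset, ?_, ecl_mono ?_ huA₀⟩
      · rw [Finite.coe_toFinset]; exact inter_subset_right
      · intro v hv
        rw [Finite.coe_toFinset]
        rcases hA₀ hv with hvX | hvb
        · exact Or.inl ⟨hv, hvX⟩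
        · exact Or.inr hvb
    choose X₀f hX₀f huX₀f using hpre
    refine ⟨b₀ ∪ Finset.univ.biUnion X₀f, ⟨Finset.univ.biUnion X₀f, ?_, rfl⟩, fun u hu => ?_⟩
    · intro v hv
      rw [Finset.mem_coe, Finset.mem_biUnion] at hv
      obtain ⟨u, -, hv⟩ := hv
      exact hX₀f u hv
    · refine ecl_mono ?_ (huX₀f ⟨u, hu⟩)
      intro v hv
      rw [Finset.mem_coe, Finset.mem_union, Finset.mem_biUnion]
      rcases hv with hv | hv
      · exact Or.inr ⟨⟨u, hu⟩, Finset.mem_univ _, hv⟩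
      · exact Or.inl hv
  have h𝔅S : ∀ bb ∈ 𝔅, ↑bb ⊆ G := by
    rintro bb ⟨X₀, hX₀, rfl⟩
    rw [Finset.coe_union]; exact union_subset hb₀G (hX₀.trans hXBG)
  have h𝔅s : ∀ bb ∈ 𝔅, IsStrong (Submodule.span ℚ (ecl (bb : Set K)) ⊔ Submodule.span ℚ (range d)) := by
    rintro bb ⟨X₀, hX₀, rfl⟩
    have hle : Submodule.span ℚ (ecl ((b₀ ∪ X₀ : Finset K) : Set K)) ≤ K₂ := by
      rw [hK₂def]
      refine Submodule.span_mono (ecl_subset_ecl_of_subset ?_)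
      rw [hG, Finset.coe_union]; exact union_subset hb₀G (hX₀.trans hXBG)
    refine isStrong_sup_span_of_td_eq hle (isGammaClosed_span_ecl_univ _).isStrong hdind hdstrong ?_
    refine hC₃ _ ?_ ?_
    · rw [Finset.coe_union]; exact hC₃b₀.trans subset_union_left
    · rw [hG, Finset.coe_union]; exact union_subset hb₀G (hX₀.trans hXBG)
  have h𝔅s' : ∀ bb ∈ 𝔅, IsStrong (Submodule.span ℚ (ecl (g '' (bb : Set K))) ⊔ Submodule.span ℚ (range d')) := by
    rintro bb hbb
    obtain ⟨X₀, hX₀, rfl⟩ := hbb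
    obtain ⟨Θ, hΘ, hΘf, hΘe⟩ := hTheta X₀ hX₀
    have hb₀X₀ : ((b₀ ∪ X₀ : Finset K) : Set K) = (b₀ : Set K) ∪ ↑X₀ := Finset.coe_union _ _
    have hsubS : (b₀ : Set K) ∪ ↑X₀ ⊆ L ∪ ↑X₀ := by rw [hLdef, hβrange]; exact union_subset_union_left _ subset_union_left
    have hΘpt : ∀ u ∈ (b₀ : Set K) ∪ ↑X₀, Θ u = g u := by
      rintro u (hu | hu)
      · obtain ⟨i, rfl⟩ : u ∈ range β := by rw [hβrange]; exact hu
        rw [hΘf (subset_ecl _ (Or.inl ⟨i, rfl⟩))]; exact hf₀β i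
      · exact hΘe u hu
    have himg1 : Θ '' ecl ((b₀ : Set K) ∪ ↑X₀) = ecl (g '' ((b₀ : Set K) ∪ ↑X₀)) := by
      rw [hΘ.image_ecl (hsubS.trans (subset_ecl _))]
      congr 1
      exact image_congr fun u hu => hΘpt u hu
    -- the image of the strong subspace
    set A₁ : Submodule ℚ K := Submodule.span ℚ (ecl ((b₀ : Set K) ∪ ↑X₀)) ⊔ Submodule.span ℚ (range d) with hA₁
    set A₁' : Submodule ℚ K' := Submodule.span ℚ (ecl (g '' ((b₀ : Set K) ∪ ↑X₀))) ⊔ Submodule.span ℚ (range d')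
      with hA₁'
    have hA₁sub : (A₁ : Set K) ⊆ ecl (L ∪ ↑X₀) := by
      intro u hu
      obtain ⟨κ₁, hκ₁, v, hv, rfl⟩ := Submodule.mem_sup.1 hu
      obtain ⟨c, rfl⟩ := (Submodule.mem_span_range_iff_exists_fun ℚ).1 hv
      rw [← SetLike.mem_coe, coe_span_ecl] at hκ₁
      exact Khovanskii.add_mem_ecl (ecl_subset_ecl_of_subset (hsubS.trans (subset_ecl _)) hκ₁)
        (sum_smul_mem_ecl c (fun j => ecl_mono subset_union_left (hdL j)) _)
    have hAA' : Θ '' (A₁ : Set K) = (A₁' : Set K') := by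
      ext u'
      constructor
      · rintro ⟨u, hu, rfl⟩
        obtain ⟨κ₁, hκ₁, v, hv, rfl⟩ := Submodule.mem_sup.1 hu
        obtain ⟨c, rfl⟩ := (Submodule.mem_span_range_iff_exists_fun ℚ).1 hv
        rw [← SetLike.mem_coe, coe_span_ecl] at hκ₁
        have hκ₁' : κ₁ ∈ ecl (L ∪ ↑X₀) := ecl_subset_ecl_of_subset (hsubS.trans (subset_ecl _)) hκ₁
        rw [hΘ.map_add_sum_smul hκ₁' c (fun j => ecl_mono subset_union_left (hdL j))]
        refine Submodule.add_mem_sup (Submodule.subset_span ?_) (Submodule.sum_mem _ fun j _ =>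
          Submodule.smul_mem _ _ (Submodule.subset_span ⟨j, ?_⟩))
        · rw [← himg1]; exact mem_image_of_mem Θ hκ₁
        · show d' j = Θ (d j); exact (hΘf (hdL j)).symm
      · intro hu'
        obtain ⟨κ₁', hκ₁', v', hv', rfl⟩ := Submodule.mem_sup.1 hu'
        obtain ⟨c, rfl⟩ := (Submodule.mem_span_range_iff_exists_fun ℚ).1 hv'
        rw [← SetLike.mem_coe, coe_span_ecl, ← himg1] at hκ₁'
        obtain ⟨κ₁, hκ₁, rfl⟩ := hκ₁'
        refine ⟨κ₁ + ∑ j, c j • d j, Submodule.add_mem_sup (Submodule.subset_span hκ₁)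
          (Submodule.sum_mem _ fun j _ => Submodule.smul_mem _ _ (Submodule.subset_span ⟨j, rfl⟩)), ?_⟩
        have hκ₁' : κ₁ ∈ ecl (L ∪ ↑X₀) := ecl_subset_ecl_of_subset (hsubS.trans (subset_ecl _)) hκ₁
        rw [hΘ.map_add_sum_smul hκ₁' c (fun j => ecl_mono subset_union_left (hdL j))]
        congr 1
        exact Finset.sum_congr rfl fun j _ => by rw [hΘf (hdL j)]
    have hs₁ : IsStrong A₁ := by
      have := h𝔅s (b₀ ∪ X₀) ⟨X₀, hX₀, rfl⟩
      rwa [hb₀X₀] at this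
    have hs₁' : IsStrong A₁' := isStrong_image_of_isEIsoOn₂ hΘ hA₁sub hAA' hs₁
    rw [hb₀X₀]
    exact hs₁'
  -- Step 5': the types over `G`
  have key := eqQFTypeOver₂_of_isGammaIsoTw₂ hK hK' hG hg hΓ 𝔅 h𝔅cof h𝔅S h𝔅s h𝔅s'
    (x := w) (x' := w') (κ := κ) (q := q) (fun i => by rw [← hG]; exact hκK₂ i) hwq hw'q
  refine ⟨fun l => w' (Fin.natAdd n l), ?_⟩
  have happ : Fin.append x' (fun l => w' (Fin.natAdd n l)) = w' := by
    funext i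
    refine Fin.addCases (fun i' => ?_) (fun l => ?_) i
    · rw [Fin.append_left]
      show x' i' = f₀ (w (Fin.castAdd k i'))
      rw [hwdef, Fin.append_left, hf₀x]
    · rw [Fin.append_right]
  rw [happ]
  exact key

/-- **Axiom (4ii) over countable closed subsets for the class of Zilber fields, across two
members** — hypothesis `h₄₄` of `ZilberClass.isQuasiminimalPregeometryClass_of`, in its `snoc`
form: for Zilber fields `H`, `H'` (members of `ZilberClass`), `G ⊆ H` countable with `cl G = G`,
`g` with `cl (g G) = g G` and `qftp(G, x) = qftp(g G, x')` along `g`, and `y ∈ cl(G ∪ x)`, there is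
`y'` with `qftp(G, x, y) = qftp(g G, x', y')` along `g` (Bays–Kirby 2013, Prop. 5 (ii), two fields:
`exists_eqQFTypeOver₂_append_of_closed`). [cite: BaysKirby2013Excellence, Prop. 5 (ii)]
[cite: Haykazyan2016, Definition 2] -/
theorem ZilberClass.exists_eqQFTypeOver₂_snoc_of_closed {H H' : Type} [Language.eclIso.Structure H]
    [Language.eclIso.Structure H'] {cl : Set H → Set H} {cl' : Set H' → Set H'}
    (hH : ZilberClass H cl) (hH' : ZilberClass H' cl') (G : Set H) (g : H → H') (_hGc : G.Countable)
    (hG : cl G = G) (hG' : cl' (g '' G) = g '' G) ⦃n : ℕ⦄ (x : Fin n → H) (x' : Fin n → H')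
    (hxx' : Language.eclIso.EqQFTypeOver₂ G g x x') ⦃y : H⦄ (hy : y ∈ cl (G ∪ range x)) :
    ∃ y' : H', Language.eclIso.EqQFTypeOver₂ G g (Fin.snoc x y) (Fin.snoc x' y') := by
  obtain ⟨_, _, _, hK, hs, rfl⟩ := hH
  obtain ⟨_, _, _, hK', hs', rfl⟩ := hH'
  subst hs hs'
  have hpe : IsPartialEmbOn Language.eclIso g G := hxx'.isPartialEmbOn
  have hg0 : IsEIsoOn₂ g G (g '' G) := isEIsoOn₂_of_isPartialEmbOn hG hpe
  have hg : IsEIsoOn₂ g (ecl G) (ecl (g '' G)) := by rw [hG, hG']; exact hg0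
  obtain ⟨z', hz'⟩ := exists_eqQFTypeOver₂_append_of_closed hK hK' hG hG' hg hxx'
    (z := fun _ : Fin 1 => y) (fun _ => hy)
  refine ⟨z' 0, ?_⟩
  rw [← Fin.append_right_eq_snoc x (fun _ : Fin 1 => y), ← Fin.append_right_eq_snoc x' z']
  exact hz'

end Main

end Literature.NumberTheory.Transcendental

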